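import Literature.AlgebraicGeometry.HodgeTheory.FermatHodgeCharactersPrimePow
import Literature.AlgebraicGeometry.Shioda1982.KoblitzOgusRelationsTwentyFourPrime
import HarnessLib

/-!
# Koblitz–Ogus relations for the Hodge multisets of level `40p` (Shioda 1982 §3 / Aoki 1983 Prop. 2.2, via Deligne LNM 900 Rem. 7.16 (a))

Topic `Literature/AlgebraicGeometry/Shioda1982`. THEOREMS (no named fact, no `sorry`): the first step towards the levels `m = 40p`
(the levels `8·5·p` of the series `PicardNumber*.lean` / `HodgeQuadruples*Prime.lean`, above `HodgeQuadruplesTwentyPrime` (`20p`) and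
the kernel table `HodgeQuadruplesForty` (level `40`): T. Shioda, *On the Picard number of a Fermat surface*, J. Fac. Sci. Univ. Tokyo
IA **28** (1982) 725–734, Prop. 4 (Q′) p. 729 with `m′ = 20p`, and the level `40` carrying the exceptional orbits of Meyer–Neutsch's
Tabelle 1, rows `N = 20, 40`): four explicit, `p`-independent families of LINEAR RELATIONS satisfied by the multiplicity function of
every Hodge multiset (`FermatCharacter.IsHodgeMultiset`) of level `40p`, `p ≥ 7` prime, in the Chinese-remainder coordinates
`ℤ/40p ≅ ℤ/40 × ℤ/p`, `w ↔ (u, c)` (**`crtPt40`**). Writing `ô(u, c) = #_{(u,c)}(s) − #_{(−u,−c)}(s)` (the tree's `oddCt`), `U` for the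
sixteen units mod `40`, `F = {5, 15, 25, 35}`, `χ₈`, `χ₋₈` for the even / odd quadratic characters of conductor `8`, `ω` for the quartic
character mod `5` with `ω(2) = i`, for every `c ≢ 0 (mod p)` — these are the four families attached to Dirichlet characters mod `40`
with `2`-part `χ₈` or `χ₋₈` that the classification of level `40p` uses (even character mod `40` with odd `ψ` mod `p` gives a relation
`= 0` fibre by fibre, odd character mod `40` with even `ψ` gives "constant in `c`"; the `2`-part must take the value `−1` at `21`
because a functional supported on odd residues satisfies `ℓ(u + 20, c) = −ℓ(u, c)`, by the distribution vectors of level `20p`):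

* **`relM8OmegaRe_fortyPrime`**, **`relM8OmegaIm_fortyPrime`** (the two real forms of the even quartic characters `χ₋₈ω^{±1}` of
  conductor `40`; a SINGLE fibre of units): `ô(1,c) − ô(9,c) + ô(11,c) − ô(19,c) − ô(21,c) + ô(29,c) − ô(31,c) + ô(39,c) = 0` and
  `−ô(3,c) − ô(7,c) + ô(13,c) + ô(17,c) + ô(23,c) + ô(27,c) − ô(33,c) − ô(37,c) = 0`;
* **`relChi8_fortyPrime`** (`χ₈`, even, conductor `8`; fibres `c, 5c`): `Σ_{u∈U} χ₈(u)(ô(u,c) + ô(u,5c)) + 4 Σ_{v∈F} χ₈(v/5) ô(v,5c) = 0`;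
* **`gammaM8_fortyPrime`** (`χ₋₈`, odd, conductor `8`; **`gammaM8Sum40`** `= −Σ_{u∈U} χ₋₈(u)(ô(u,c) + ô(u,5c)) − 4 Σ_{v∈F} χ₋₈(v/5) ô(v,5c)`
  is constant in `c ≠ 0`).

PROOF (this formalisation's; the printed route is Shioda's inductive structure / Aoki's Prop. 2.2): by the tree's PROVED
`KoblitzOgus.hodge_eq_combination` [Deligne1982HodgeCycles, Rem. 7.16 (a)] the multiplicity function of a Hodge multiset of level `N`
is a `ℚ`-combination of reflection vectors `e_a + e_{−a}` and distribution vectors `D_{M,z} = 𝟙[· ≡ z (M)] − 𝟙[· = (N/M) z]`, `M ∣ N`;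
the functionals are odd and annihilate every `D_{M,z}`, `M ∣ 40p` — checked divisor class by divisor class (`M = k`, `k·p` for
`k ∣ 40`) in coordinates, where each check is a finite computation in `ℤ/40`. WHY THESE (cell `pub-hfermat`, LIT g30 seat numerics
`scope40rel.py`, `scope40_sectors.py`, `check40.py`, copied to `code/lit/picard/`): the space of odd functionals on `ℚ^{ℤ/40p}`
annihilating all `D_{M,z}` has dimension `8(p − 1)`, one per odd character of `(ℤ/40p)ˣ`; solving for all functionals of the shape
`Σ a_{u,λ} ô(u, λc)` (`λ ∣ 40`) in exact arithmetic at `p = 17, 23` and decomposing by the characters of `(ℤ/40)ˣ ≅ C₂ × C₂ × C₄` gives,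
among the twelve rational sectors, eight families whose tables are supported on ODD residues mod `40` (so that even members are
invisible to them), of which these four already force the table lemmas of the classification; `check40.py`: all eight hold on all
`328 / 476` pair-free Hodge `4`-multisets of the levels `280, 440`, the constant ones being `≡ 0` there. They are the input for the
classification of the indecomposable Hodge quadruples of level `40p` (not carried out in this file).

HONEST FRAMING (cell `pub-hfermat`): explicit algebraic cycles for specific Hodge classes on Fermat/Delsarte varieties; residual open
instances listed; no claim on general Hodge. (Surface classes are algebraic by Lefschetz (1,1); this file proves linear identities
that follow from a printed theorem.)

## References
* [Deligne1982HodgeCycles] P. Deligne, *Hodge cycles on abelian varieties*, LNM 900 (1982), Rem. 7.16 (a) (Koblitz–Ogus), through the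
  tree's `Literature.NumberTheory.Transcendental.KoblitzOgus.hodge_eq_combination`.
* [Aoki1983] N. Aoki, *On some arithmetic problems related to the Hodge cycles on the Fermat varieties*, Math. Ann. 266 (1983) 23–54,
  Prop. 2.2 (relations among Hodge cycles under level change).
* [Shioda1982PicardFermat] T. Shioda, J. Fac. Sci. Univ. Tokyo IA 28 (1982) 725–734, §3 p. 727 (the method), Prop. 4 (Q′) p. 729,
  table p. 727 (row `m = 40`).
* [Shioda1979PJA] T. Shioda, Proc. Japan Acad. 55A (1979), §1 (2) (the Hodge condition).
-/

namespace Literature.AlgebraicGeometry.Shioda1982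

open Finset Multiset Literature.AlgebraicGeometry.HodgeTheory Literature.AlgebraicGeometry.HodgeTheory.FermatCharacter

section FortyPrime

variable {p : ℕ}

set_option linter.unusedSimpArgs false -- one uniform list of atom rewrites across the generated divisor-class checks (as in `KoblitzOgusRelationsTwentyPrime`)

/-! ### `ℤ/40p ≅ ℤ/40 × ℤ/p`: Chinese-remainder coordinates -/

/-- The Chinese-remainder isomorphism `ℤ/40p ≃+* ℤ/40 × ℤ/p`. [folklore] -/
private def crt (h : Nat.Coprime 40 p) : ZMod (40 * p) ≃+* ZMod 40 × ZMod p := ZMod.chineseRemainder h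

/-- The residue with coordinates `(e, b)`. [folklore] -/
private def pt (h : Nat.Coprime 40 p) (e : ZMod 40) (b : ZMod p) : ZMod (40 * p) := (crt h).symm (e, b)

/-- First coordinate = residue mod `40`. [folklore] -/
private theorem crt_fst (h : Nat.Coprime 40 p) [NeZero (40 * p)] (w : ZMod (40 * p)) :
    (crt h w).1 = (w.val : ZMod 40) := by
  conv_lhs => rw [← ZMod.natCast_zmod_val w]
  rw [map_natCast, Prod.fst_natCast]

/-- Second coordinate = residue mod `p`. [folklore] -/
private theorem crt_snd (h : Nat.Coprime 40 p) [NeZero (40 * p)] (w : ZMod (40 * p)) :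
    (crt h w).2 = (w.val : ZMod p) := by
  conv_lhs => rw [← ZMod.natCast_zmod_val w]
  rw [map_natCast, Prod.snd_natCast]

/-- `crt (pt e b) = (e, b)`. [folklore] -/
private theorem crt_pt (h : Nat.Coprime 40 p) (e : ZMod 40) (b : ZMod p) : crt h (pt h e b) = (e, b) :=
  (crt h).apply_symm_apply (e, b)

/-- `pt (crt w) = w`. [folklore] -/
private theorem pt_crt (h : Nat.Coprime 40 p) (w : ZMod (40 * p)) : pt h (crt h w).1 (crt h w).2 = w :=
  (crt h).symm_apply_apply w

/-- `pt` is injective. [folklore] -/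
private theorem pt_inj (h : Nat.Coprime 40 p) {e e' : ZMod 40} {b b' : ZMod p} :
    pt h e b = pt h e' b' ↔ e = e' ∧ b = b' := by
  rw [pt, pt, (crt h).symm.injective.eq_iff, Prod.mk.injEq]

/-- `pt` and negation. [folklore] -/
private theorem neg_pt (h : Nat.Coprime 40 p) (e : ZMod 40) (b : ZMod p) : -pt h e b = pt h (-e) (-b) := by
  rw [pt, pt, ← (crt h).symm.map_neg, Prod.neg_mk]

/-- `pt` and natural multiples. [folklore] -/
private theorem natCast_mul_pt (h : Nat.Coprime 40 p) (k : ℕ) (e : ZMod 40) (b : ZMod p) :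
    (k : ZMod (40 * p)) * pt h e b = pt h (k * e) (k * b) := by
  rw [pt, pt, ← nsmul_eq_mul, ← _root_.map_nsmul, Prod.smul_mk, nsmul_eq_mul, nsmul_eq_mul]

/-! ### The Koblitz–Ogus distribution vectors in Chinese-remainder coordinates -/

/-- The Koblitz–Ogus distribution vector of level `M ∣ 40p` through `z` (as in `KoblitzOgus.hodge_eq_combination`):
`w ↦ [w ≡ z (mod M)] − [(40p/M)·z = w]`. [cite: Deligne1982HodgeCycles, Rem. 7.16 (a)] -/
private def koD (N : ℕ) (M : ℕ) (z w : ZMod N) : ℚ :=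
  (if w.val % M = z.val % M then (1 : ℚ) else 0) - (if ((N / M : ℕ) : ZMod N) * z = w then 1 else 0)

/-- The divisors of `40p`. [folklore] -/
private theorem eq_of_dvd_forty_mul_prime (hp : p.Prime) (h7 : 7 ≤ p) {M : ℕ} (hM : M ∣ 40 * p) :
    M = 1 ∨ M = 2 ∨ M = 4 ∨ M = 5 ∨ M = 8 ∨ M = 10 ∨ M = 20 ∨ M = 40 ∨ M = p ∨ M = 2 * p ∨ M = 4 * p ∨ M = 5 * p ∨
      M = 8 * p ∨ M = 10 * p ∨ M = 20 * p ∨ M = 40 * p := by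
  obtain ⟨a, b, ha, hb, rfl⟩ := (Nat.dvd_mul.1 hM)
  have ha' : a = 1 ∨ a = 2 ∨ a = 4 ∨ a = 5 ∨ a = 8 ∨ a = 10 ∨ a = 20 ∨ a = 40 := by
    have := Nat.le_of_dvd (by norm_num) ha
    interval_cases a <;> simp_all
  rcases (Nat.dvd_prime hp).1 hb with rfl | rfl <;> rcases ha' with rfl | rfl | rfl | rfl | rfl | rfl | rfl | rfl <;> simp

/-- Congruence mod `p` in coordinates. [folklore] -/
private theorem mod_p_iff (h : Nat.Coprime 40 p) [NeZero (40 * p)] (w z : ZMod (40 * p)) :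
    w.val % p = z.val % p ↔ (crt h w).2 = (crt h z).2 := by
  rw [crt_snd, crt_snd, ZMod.natCast_eq_natCast_iff']

/-- Congruence mod a divisor `k` of `40` in coordinates. [folklore] -/
private theorem mod_dvd_forty_iff (h : Nat.Coprime 40 p) [NeZero (40 * p)] {k : ℕ} (hk : k ∣ 40)
    (w z : ZMod (40 * p)) : w.val % k = z.val % k ↔ (crt h w).1.val % k = (crt h z).1.val % k := by
  rw [crt_fst, crt_fst, ZMod.val_natCast, ZMod.val_natCast, Nat.mod_mod_of_dvd _ hk, Nat.mod_mod_of_dvd _ hk]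

/-- Congruence mod `k·p`, `k ∣ 40`, in coordinates. [folklore] -/
private theorem mod_dvd_forty_mul_iff (h : Nat.Coprime 40 p) [NeZero (40 * p)] {k : ℕ} (hk : k ∣ 40)
    (w z : ZMod (40 * p)) :
    w.val % (k * p) = z.val % (k * p) ↔ (crt h w).1.val % k = (crt h z).1.val % k ∧ (crt h w).2 = (crt h z).2 := by
  have hkp : Nat.Coprime k p := Nat.Coprime.coprime_dvd_left hk h
  rw [← mod_dvd_forty_iff h hk, ← mod_p_iff]
  exact (Nat.modEq_and_modEq_iff_modEq_mul hkp).symm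

/-- A multiple of `z = pt e b` in coordinates. [folklore] -/
private theorem natCast_mul_eq_pt_iff (h : Nat.Coprime 40 p) (k : ℕ) (ez e : ZMod 40) (bz c : ZMod p) :
    (k : ZMod (40 * p)) * pt h ez bz = pt h e c ↔ (k : ZMod 40) * ez = e ∧ (k : ZMod p) * bz = c := by
  rw [natCast_mul_pt, pt_inj]

/-- A divisor of `40` is non-zero in `ℤ/p` for a prime `p ≥ 7`. [folklore] -/
private theorem cast_ne_zero (hp : p.Prime) (h7 : 7 ≤ p) {k : ℕ} (hk : k ∣ 40) : (k : ZMod p) ≠ 0 := by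
  intro h0
  rw [ZMod.natCast_eq_zero_iff] at h0
  have h40 : p ∣ 8 * 5 := (dvd_trans h0 hk)
  rcases (Nat.Prime.dvd_mul hp).1 h40 with h8 | h5
  · rcases (Nat.Prime.dvd_mul hp).1 (show p ∣ 2 * 4 from h8) with h2 | h4
    · exact absurd (Nat.le_of_dvd (by norm_num) h2) (by omega)
    · rcases (Nat.Prime.dvd_mul hp).1 (show p ∣ 2 * 2 from h4) with h2 | h2 <;>
        exact absurd (Nat.le_of_dvd (by norm_num) h2) (by omega)
  · exact absurd (Nat.le_of_dvd (by norm_num) h5) (by omega)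

/-- Cancellation of a non-zero numeral factor `g` in an equation `g·A′ = g·B′` of `ℤ/p`, in the orientation used below
(`A = B ↔ B′ = A′`). [folklore] -/
private theorem atom_iff (hp : p.Prime) {g : ℕ} (hg : (g : ZMod p) ≠ 0) {A B A' B' : ZMod p}
    (hA : A = (g : ZMod p) * A') (hB : B = (g : ZMod p) * B') : (A = B ↔ B' = A') := by
  haveI := Fact.mk hp
  constructor
  · intro e; rw [hA, hB] at e; exact (mul_left_cancel₀ hg e).symm
  · intro e; rw [hA, hB, e]

/-! ### The point atoms of the distribution vectors at the fibres `λc`, `λ ∣ 40` -/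

/-- Point atom `40·x = 1·c` reduced by `1`. [folklore] -/
private theorem atm_40_1p (hp : p.Prime) (h7 : 7 ≤ p) (c x : ZMod p) :
    ((40 : ZMod p) * x = c ↔ c = 40 * x) :=
  atom_iff hp (cast_ne_zero hp h7 (k := 1) (by norm_num)) (A' := 40 * x) (B' := c) (by push_cast; ring) (by push_cast; ring)

/-- Point atom `40·x = −1·c` reduced by `1`. [folklore] -/
private theorem atm_40_1n (hp : p.Prime) (h7 : 7 ≤ p) (c x : ZMod p) :
    ((40 : ZMod p) * x = -c ↔ -c = 40 * x) :=
  atom_iff hp (cast_ne_zero hp h7 (k := 1) (by norm_num)) (A' := 40 * x) (B' := -c) (by push_cast; ring) (by push_cast; ring)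

/-- Point atom `40·x = 2·c` reduced by `2`. [folklore] -/
private theorem atm_40_2p (hp : p.Prime) (h7 : 7 ≤ p) (c x : ZMod p) :
    ((40 : ZMod p) * x = 2 * c ↔ c = 20 * x) :=
  atom_iff hp (cast_ne_zero hp h7 (k := 2) (by norm_num)) (A' := 20 * x) (B' := c) (by push_cast; ring) (by push_cast; ring)

/-- Point atom `40·x = −2·c` reduced by `2`. [folklore] -/
private theorem atm_40_2n (hp : p.Prime) (h7 : 7 ≤ p) (c x : ZMod p) :
    ((40 : ZMod p) * x = -(2 * c) ↔ -c = 20 * x) :=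
  atom_iff hp (cast_ne_zero hp h7 (k := 2) (by norm_num)) (A' := 20 * x) (B' := -c) (by push_cast; ring) (by push_cast; ring)

/-- Point atom `40·x = 4·c` reduced by `4`. [folklore] -/
private theorem atm_40_4p (hp : p.Prime) (h7 : 7 ≤ p) (c x : ZMod p) :
    ((40 : ZMod p) * x = 4 * c ↔ c = 10 * x) :=
  atom_iff hp (cast_ne_zero hp h7 (k := 4) (by norm_num)) (A' := 10 * x) (B' := c) (by push_cast; ring) (by push_cast; ring)

/-- Point atom `40·x = −4·c` reduced by `4`. [folklore] -/
private theorem atm_40_4n (hp : p.Prime) (h7 : 7 ≤ p) (c x : ZMod p) :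
    ((40 : ZMod p) * x = -(4 * c) ↔ -c = 10 * x) :=
  atom_iff hp (cast_ne_zero hp h7 (k := 4) (by norm_num)) (A' := 10 * x) (B' := -c) (by push_cast; ring) (by push_cast; ring)

/-- Point atom `40·x = 5·c` reduced by `5`. [folklore] -/
private theorem atm_40_5p (hp : p.Prime) (h7 : 7 ≤ p) (c x : ZMod p) :
    ((40 : ZMod p) * x = 5 * c ↔ c = 8 * x) :=
  atom_iff hp (cast_ne_zero hp h7 (k := 5) (by norm_num)) (A' := 8 * x) (B' := c) (by push_cast; ring) (by push_cast; ring)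

/-- Point atom `40·x = −5·c` reduced by `5`. [folklore] -/
private theorem atm_40_5n (hp : p.Prime) (h7 : 7 ≤ p) (c x : ZMod p) :
    ((40 : ZMod p) * x = -(5 * c) ↔ -c = 8 * x) :=
  atom_iff hp (cast_ne_zero hp h7 (k := 5) (by norm_num)) (A' := 8 * x) (B' := -c) (by push_cast; ring) (by push_cast; ring)

/-- Point atom `40·x = 8·c` reduced by `8`. [folklore] -/
private theorem atm_40_8p (hp : p.Prime) (h7 : 7 ≤ p) (c x : ZMod p) :
    ((40 : ZMod p) * x = 8 * c ↔ c = 5 * x) :=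
  atom_iff hp (cast_ne_zero hp h7 (k := 8) (by norm_num)) (A' := 5 * x) (B' := c) (by push_cast; ring) (by push_cast; ring)

/-- Point atom `40·x = −8·c` reduced by `8`. [folklore] -/
private theorem atm_40_8n (hp : p.Prime) (h7 : 7 ≤ p) (c x : ZMod p) :
    ((40 : ZMod p) * x = -(8 * c) ↔ -c = 5 * x) :=
  atom_iff hp (cast_ne_zero hp h7 (k := 8) (by norm_num)) (A' := 5 * x) (B' := -c) (by push_cast; ring) (by push_cast; ring)

/-- Point atom `40·x = 10·c` reduced by `10`. [folklore] -/
private theorem atm_40_10p (hp : p.Prime) (h7 : 7 ≤ p) (c x : ZMod p) :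
    ((40 : ZMod p) * x = 10 * c ↔ c = 4 * x) :=
  atom_iff hp (cast_ne_zero hp h7 (k := 10) (by norm_num)) (A' := 4 * x) (B' := c) (by push_cast; ring) (by push_cast; ring)

/-- Point atom `40·x = −10·c` reduced by `10`. [folklore] -/
private theorem atm_40_10n (hp : p.Prime) (h7 : 7 ≤ p) (c x : ZMod p) :
    ((40 : ZMod p) * x = -(10 * c) ↔ -c = 4 * x) :=
  atom_iff hp (cast_ne_zero hp h7 (k := 10) (by norm_num)) (A' := 4 * x) (B' := -c) (by push_cast; ring) (by push_cast; ring)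

/-- Point atom `40·x = 20·c` reduced by `20`. [folklore] -/
private theorem atm_40_20p (hp : p.Prime) (h7 : 7 ≤ p) (c x : ZMod p) :
    ((40 : ZMod p) * x = 20 * c ↔ c = 2 * x) :=
  atom_iff hp (cast_ne_zero hp h7 (k := 20) (by norm_num)) (A' := 2 * x) (B' := c) (by push_cast; ring) (by push_cast; ring)

/-- Point atom `40·x = −20·c` reduced by `20`. [folklore] -/
private theorem atm_40_20n (hp : p.Prime) (h7 : 7 ≤ p) (c x : ZMod p) :
    ((40 : ZMod p) * x = -(20 * c) ↔ -c = 2 * x) :=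
  atom_iff hp (cast_ne_zero hp h7 (k := 20) (by norm_num)) (A' := 2 * x) (B' := -c) (by push_cast; ring) (by push_cast; ring)

/-- Point atom `40·x = 40·c` reduced by `40`. [folklore] -/
private theorem atm_40_40p (hp : p.Prime) (h7 : 7 ≤ p) (c x : ZMod p) :
    ((40 : ZMod p) * x = 40 * c ↔ c = x) :=
  atom_iff hp (cast_ne_zero hp h7 (k := 40) (by norm_num)) (A' := x) (B' := c) (by push_cast; ring) (by push_cast; ring)

/-- Point atom `40·x = −40·c` reduced by `40`. [folklore] -/
private theorem atm_40_40n (hp : p.Prime) (h7 : 7 ≤ p) (c x : ZMod p) :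
    ((40 : ZMod p) * x = -(40 * c) ↔ -c = x) :=
  atom_iff hp (cast_ne_zero hp h7 (k := 40) (by norm_num)) (A' := x) (B' := -c) (by push_cast; ring) (by push_cast; ring)

/-- Point atom `20·x = 1·c` reduced by `1`. [folklore] -/
private theorem atm_20_1p (hp : p.Prime) (h7 : 7 ≤ p) (c x : ZMod p) :
    ((20 : ZMod p) * x = c ↔ c = 20 * x) :=
  atom_iff hp (cast_ne_zero hp h7 (k := 1) (by norm_num)) (A' := 20 * x) (B' := c) (by push_cast; ring) (by push_cast; ring)

/-- Point atom `20·x = −1·c` reduced by `1`. [folklore] -/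
private theorem atm_20_1n (hp : p.Prime) (h7 : 7 ≤ p) (c x : ZMod p) :
    ((20 : ZMod p) * x = -c ↔ -c = 20 * x) :=
  atom_iff hp (cast_ne_zero hp h7 (k := 1) (by norm_num)) (A' := 20 * x) (B' := -c) (by push_cast; ring) (by push_cast; ring)

/-- Point atom `20·x = 2·c` reduced by `2`. [folklore] -/
private theorem atm_20_2p (hp : p.Prime) (h7 : 7 ≤ p) (c x : ZMod p) :
    ((20 : ZMod p) * x = 2 * c ↔ c = 10 * x) :=
  atom_iff hp (cast_ne_zero hp h7 (k := 2) (by norm_num)) (A' := 10 * x) (B' := c) (by push_cast; ring) (by push_cast; ring)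

/-- Point atom `20·x = −2·c` reduced by `2`. [folklore] -/
private theorem atm_20_2n (hp : p.Prime) (h7 : 7 ≤ p) (c x : ZMod p) :
    ((20 : ZMod p) * x = -(2 * c) ↔ -c = 10 * x) :=
  atom_iff hp (cast_ne_zero hp h7 (k := 2) (by norm_num)) (A' := 10 * x) (B' := -c) (by push_cast; ring) (by push_cast; ring)

/-- Point atom `20·x = 4·c` reduced by `4`. [folklore] -/
private theorem atm_20_4p (hp : p.Prime) (h7 : 7 ≤ p) (c x : ZMod p) :
    ((20 : ZMod p) * x = 4 * c ↔ c = 5 * x) :=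
  atom_iff hp (cast_ne_zero hp h7 (k := 4) (by norm_num)) (A' := 5 * x) (B' := c) (by push_cast; ring) (by push_cast; ring)

/-- Point atom `20·x = −4·c` reduced by `4`. [folklore] -/
private theorem atm_20_4n (hp : p.Prime) (h7 : 7 ≤ p) (c x : ZMod p) :
    ((20 : ZMod p) * x = -(4 * c) ↔ -c = 5 * x) :=
  atom_iff hp (cast_ne_zero hp h7 (k := 4) (by norm_num)) (A' := 5 * x) (B' := -c) (by push_cast; ring) (by push_cast; ring)

/-- Point atom `20·x = 5·c` reduced by `5`. [folklore] -/
private theorem atm_20_5p (hp : p.Prime) (h7 : 7 ≤ p) (c x : ZMod p) :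
    ((20 : ZMod p) * x = 5 * c ↔ c = 4 * x) :=
  atom_iff hp (cast_ne_zero hp h7 (k := 5) (by norm_num)) (A' := 4 * x) (B' := c) (by push_cast; ring) (by push_cast; ring)

/-- Point atom `20·x = −5·c` reduced by `5`. [folklore] -/
private theorem atm_20_5n (hp : p.Prime) (h7 : 7 ≤ p) (c x : ZMod p) :
    ((20 : ZMod p) * x = -(5 * c) ↔ -c = 4 * x) :=
  atom_iff hp (cast_ne_zero hp h7 (k := 5) (by norm_num)) (A' := 4 * x) (B' := -c) (by push_cast; ring) (by push_cast; ring)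

/-- Point atom `20·x = 8·c` reduced by `4`. [folklore] -/
private theorem atm_20_8p (hp : p.Prime) (h7 : 7 ≤ p) (c x : ZMod p) :
    ((20 : ZMod p) * x = 8 * c ↔ 2 * c = 5 * x) :=
  atom_iff hp (cast_ne_zero hp h7 (k := 4) (by norm_num)) (A' := 5 * x) (B' := 2 * c) (by push_cast; ring) (by push_cast; ring)

/-- Point atom `20·x = −8·c` reduced by `4`. [folklore] -/
private theorem atm_20_8n (hp : p.Prime) (h7 : 7 ≤ p) (c x : ZMod p) :
    ((20 : ZMod p) * x = -(8 * c) ↔ -(2 * c) = 5 * x) :=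
  atom_iff hp (cast_ne_zero hp h7 (k := 4) (by norm_num)) (A' := 5 * x) (B' := -(2 * c)) (by push_cast; ring) (by push_cast; ring)

/-- Point atom `20·x = 10·c` reduced by `10`. [folklore] -/
private theorem atm_20_10p (hp : p.Prime) (h7 : 7 ≤ p) (c x : ZMod p) :
    ((20 : ZMod p) * x = 10 * c ↔ c = 2 * x) :=
  atom_iff hp (cast_ne_zero hp h7 (k := 10) (by norm_num)) (A' := 2 * x) (B' := c) (by push_cast; ring) (by push_cast; ring)

/-- Point atom `20·x = −10·c` reduced by `10`. [folklore] -/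
private theorem atm_20_10n (hp : p.Prime) (h7 : 7 ≤ p) (c x : ZMod p) :
    ((20 : ZMod p) * x = -(10 * c) ↔ -c = 2 * x) :=
  atom_iff hp (cast_ne_zero hp h7 (k := 10) (by norm_num)) (A' := 2 * x) (B' := -c) (by push_cast; ring) (by push_cast; ring)

/-- Point atom `20·x = 20·c` reduced by `20`. [folklore] -/
private theorem atm_20_20p (hp : p.Prime) (h7 : 7 ≤ p) (c x : ZMod p) :
    ((20 : ZMod p) * x = 20 * c ↔ c = x) :=
  atom_iff hp (cast_ne_zero hp h7 (k := 20) (by norm_num)) (A' := x) (B' := c) (by push_cast; ring) (by push_cast; ring)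

/-- Point atom `20·x = −20·c` reduced by `20`. [folklore] -/
private theorem atm_20_20n (hp : p.Prime) (h7 : 7 ≤ p) (c x : ZMod p) :
    ((20 : ZMod p) * x = -(20 * c) ↔ -c = x) :=
  atom_iff hp (cast_ne_zero hp h7 (k := 20) (by norm_num)) (A' := x) (B' := -c) (by push_cast; ring) (by push_cast; ring)

/-- Point atom `20·x = 40·c` reduced by `20`. [folklore] -/
private theorem atm_20_40p (hp : p.Prime) (h7 : 7 ≤ p) (c x : ZMod p) :
    ((20 : ZMod p) * x = 40 * c ↔ 2 * c = x) :=
  atom_iff hp (cast_ne_zero hp h7 (k := 20) (by norm_num)) (A' := x) (B' := 2 * c) (by push_cast; ring) (by push_cast; ring)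

/-- Point atom `20·x = −40·c` reduced by `20`. [folklore] -/
private theorem atm_20_40n (hp : p.Prime) (h7 : 7 ≤ p) (c x : ZMod p) :
    ((20 : ZMod p) * x = -(40 * c) ↔ -(2 * c) = x) :=
  atom_iff hp (cast_ne_zero hp h7 (k := 20) (by norm_num)) (A' := x) (B' := -(2 * c)) (by push_cast; ring) (by push_cast; ring)

/-- Point atom `10·x = 1·c` reduced by `1`. [folklore] -/
private theorem atm_10_1p (hp : p.Prime) (h7 : 7 ≤ p) (c x : ZMod p) :
    ((10 : ZMod p) * x = c ↔ c = 10 * x) :=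
  atom_iff hp (cast_ne_zero hp h7 (k := 1) (by norm_num)) (A' := 10 * x) (B' := c) (by push_cast; ring) (by push_cast; ring)

/-- Point atom `10·x = −1·c` reduced by `1`. [folklore] -/
private theorem atm_10_1n (hp : p.Prime) (h7 : 7 ≤ p) (c x : ZMod p) :
    ((10 : ZMod p) * x = -c ↔ -c = 10 * x) :=
  atom_iff hp (cast_ne_zero hp h7 (k := 1) (by norm_num)) (A' := 10 * x) (B' := -c) (by push_cast; ring) (by push_cast; ring)

/-- Point atom `10·x = 2·c` reduced by `2`. [folklore] -/
private theorem atm_10_2p (hp : p.Prime) (h7 : 7 ≤ p) (c x : ZMod p) :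
    ((10 : ZMod p) * x = 2 * c ↔ c = 5 * x) :=
  atom_iff hp (cast_ne_zero hp h7 (k := 2) (by norm_num)) (A' := 5 * x) (B' := c) (by push_cast; ring) (by push_cast; ring)

/-- Point atom `10·x = −2·c` reduced by `2`. [folklore] -/
private theorem atm_10_2n (hp : p.Prime) (h7 : 7 ≤ p) (c x : ZMod p) :
    ((10 : ZMod p) * x = -(2 * c) ↔ -c = 5 * x) :=
  atom_iff hp (cast_ne_zero hp h7 (k := 2) (by norm_num)) (A' := 5 * x) (B' := -c) (by push_cast; ring) (by push_cast; ring)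

/-- Point atom `10·x = 4·c` reduced by `2`. [folklore] -/
private theorem atm_10_4p (hp : p.Prime) (h7 : 7 ≤ p) (c x : ZMod p) :
    ((10 : ZMod p) * x = 4 * c ↔ 2 * c = 5 * x) :=
  atom_iff hp (cast_ne_zero hp h7 (k := 2) (by norm_num)) (A' := 5 * x) (B' := 2 * c) (by push_cast; ring) (by push_cast; ring)

/-- Point atom `10·x = −4·c` reduced by `2`. [folklore] -/
private theorem atm_10_4n (hp : p.Prime) (h7 : 7 ≤ p) (c x : ZMod p) :
    ((10 : ZMod p) * x = -(4 * c) ↔ -(2 * c) = 5 * x) :=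
  atom_iff hp (cast_ne_zero hp h7 (k := 2) (by norm_num)) (A' := 5 * x) (B' := -(2 * c)) (by push_cast; ring) (by push_cast; ring)

/-- Point atom `10·x = 5·c` reduced by `5`. [folklore] -/
private theorem atm_10_5p (hp : p.Prime) (h7 : 7 ≤ p) (c x : ZMod p) :
    ((10 : ZMod p) * x = 5 * c ↔ c = 2 * x) :=
  atom_iff hp (cast_ne_zero hp h7 (k := 5) (by norm_num)) (A' := 2 * x) (B' := c) (by push_cast; ring) (by push_cast; ring)

/-- Point atom `10·x = −5·c` reduced by `5`. [folklore] -/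
private theorem atm_10_5n (hp : p.Prime) (h7 : 7 ≤ p) (c x : ZMod p) :
    ((10 : ZMod p) * x = -(5 * c) ↔ -c = 2 * x) :=
  atom_iff hp (cast_ne_zero hp h7 (k := 5) (by norm_num)) (A' := 2 * x) (B' := -c) (by push_cast; ring) (by push_cast; ring)

/-- Point atom `10·x = 8·c` reduced by `2`. [folklore] -/
private theorem atm_10_8p (hp : p.Prime) (h7 : 7 ≤ p) (c x : ZMod p) :
    ((10 : ZMod p) * x = 8 * c ↔ 4 * c = 5 * x) :=
  atom_iff hp (cast_ne_zero hp h7 (k := 2) (by norm_num)) (A' := 5 * x) (B' := 4 * c) (by push_cast; ring) (by push_cast; ring)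

/-- Point atom `10·x = −8·c` reduced by `2`. [folklore] -/
private theorem atm_10_8n (hp : p.Prime) (h7 : 7 ≤ p) (c x : ZMod p) :
    ((10 : ZMod p) * x = -(8 * c) ↔ -(4 * c) = 5 * x) :=
  atom_iff hp (cast_ne_zero hp h7 (k := 2) (by norm_num)) (A' := 5 * x) (B' := -(4 * c)) (by push_cast; ring) (by push_cast; ring)

/-- Point atom `10·x = 10·c` reduced by `10`. [folklore] -/
private theorem atm_10_10p (hp : p.Prime) (h7 : 7 ≤ p) (c x : ZMod p) :
    ((10 : ZMod p) * x = 10 * c ↔ c = x) :=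
  atom_iff hp (cast_ne_zero hp h7 (k := 10) (by norm_num)) (A' := x) (B' := c) (by push_cast; ring) (by push_cast; ring)

/-- Point atom `10·x = −10·c` reduced by `10`. [folklore] -/
private theorem atm_10_10n (hp : p.Prime) (h7 : 7 ≤ p) (c x : ZMod p) :
    ((10 : ZMod p) * x = -(10 * c) ↔ -c = x) :=
  atom_iff hp (cast_ne_zero hp h7 (k := 10) (by norm_num)) (A' := x) (B' := -c) (by push_cast; ring) (by push_cast; ring)

/-- Point atom `10·x = 20·c` reduced by `10`. [folklore] -/
private theorem atm_10_20p (hp : p.Prime) (h7 : 7 ≤ p) (c x : ZMod p) :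
    ((10 : ZMod p) * x = 20 * c ↔ 2 * c = x) :=
  atom_iff hp (cast_ne_zero hp h7 (k := 10) (by norm_num)) (A' := x) (B' := 2 * c) (by push_cast; ring) (by push_cast; ring)

/-- Point atom `10·x = −20·c` reduced by `10`. [folklore] -/
private theorem atm_10_20n (hp : p.Prime) (h7 : 7 ≤ p) (c x : ZMod p) :
    ((10 : ZMod p) * x = -(20 * c) ↔ -(2 * c) = x) :=
  atom_iff hp (cast_ne_zero hp h7 (k := 10) (by norm_num)) (A' := x) (B' := -(2 * c)) (by push_cast; ring) (by push_cast; ring)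

/-- Point atom `10·x = 40·c` reduced by `10`. [folklore] -/
private theorem atm_10_40p (hp : p.Prime) (h7 : 7 ≤ p) (c x : ZMod p) :
    ((10 : ZMod p) * x = 40 * c ↔ 4 * c = x) :=
  atom_iff hp (cast_ne_zero hp h7 (k := 10) (by norm_num)) (A' := x) (B' := 4 * c) (by push_cast; ring) (by push_cast; ring)

/-- Point atom `10·x = −40·c` reduced by `10`. [folklore] -/
private theorem atm_10_40n (hp : p.Prime) (h7 : 7 ≤ p) (c x : ZMod p) :
    ((10 : ZMod p) * x = -(40 * c) ↔ -(4 * c) = x) :=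
  atom_iff hp (cast_ne_zero hp h7 (k := 10) (by norm_num)) (A' := x) (B' := -(4 * c)) (by push_cast; ring) (by push_cast; ring)

/-- Point atom `8·x = 1·c` reduced by `1`. [folklore] -/
private theorem atm_8_1p (hp : p.Prime) (h7 : 7 ≤ p) (c x : ZMod p) :
    ((8 : ZMod p) * x = c ↔ c = 8 * x) :=
  atom_iff hp (cast_ne_zero hp h7 (k := 1) (by norm_num)) (A' := 8 * x) (B' := c) (by push_cast; ring) (by push_cast; ring)

/-- Point atom `8·x = −1·c` reduced by `1`. [folklore] -/
private theorem atm_8_1n (hp : p.Prime) (h7 : 7 ≤ p) (c x : ZMod p) :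
    ((8 : ZMod p) * x = -c ↔ -c = 8 * x) :=
  atom_iff hp (cast_ne_zero hp h7 (k := 1) (by norm_num)) (A' := 8 * x) (B' := -c) (by push_cast; ring) (by push_cast; ring)

/-- Point atom `8·x = 2·c` reduced by `2`. [folklore] -/
private theorem atm_8_2p (hp : p.Prime) (h7 : 7 ≤ p) (c x : ZMod p) :
    ((8 : ZMod p) * x = 2 * c ↔ c = 4 * x) :=
  atom_iff hp (cast_ne_zero hp h7 (k := 2) (by norm_num)) (A' := 4 * x) (B' := c) (by push_cast; ring) (by push_cast; ring)

/-- Point atom `8·x = −2·c` reduced by `2`. [folklore] -/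
private theorem atm_8_2n (hp : p.Prime) (h7 : 7 ≤ p) (c x : ZMod p) :
    ((8 : ZMod p) * x = -(2 * c) ↔ -c = 4 * x) :=
  atom_iff hp (cast_ne_zero hp h7 (k := 2) (by norm_num)) (A' := 4 * x) (B' := -c) (by push_cast; ring) (by push_cast; ring)

/-- Point atom `8·x = 4·c` reduced by `4`. [folklore] -/
private theorem atm_8_4p (hp : p.Prime) (h7 : 7 ≤ p) (c x : ZMod p) :
    ((8 : ZMod p) * x = 4 * c ↔ c = 2 * x) :=
  atom_iff hp (cast_ne_zero hp h7 (k := 4) (by norm_num)) (A' := 2 * x) (B' := c) (by push_cast; ring) (by push_cast; ring)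

/-- Point atom `8·x = −4·c` reduced by `4`. [folklore] -/
private theorem atm_8_4n (hp : p.Prime) (h7 : 7 ≤ p) (c x : ZMod p) :
    ((8 : ZMod p) * x = -(4 * c) ↔ -c = 2 * x) :=
  atom_iff hp (cast_ne_zero hp h7 (k := 4) (by norm_num)) (A' := 2 * x) (B' := -c) (by push_cast; ring) (by push_cast; ring)

/-- Point atom `8·x = 5·c` reduced by `1`. [folklore] -/
private theorem atm_8_5p (hp : p.Prime) (h7 : 7 ≤ p) (c x : ZMod p) :
    ((8 : ZMod p) * x = 5 * c ↔ 5 * c = 8 * x) :=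
  atom_iff hp (cast_ne_zero hp h7 (k := 1) (by norm_num)) (A' := 8 * x) (B' := 5 * c) (by push_cast; ring) (by push_cast; ring)

/-- Point atom `8·x = −5·c` reduced by `1`. [folklore] -/
private theorem atm_8_5n (hp : p.Prime) (h7 : 7 ≤ p) (c x : ZMod p) :
    ((8 : ZMod p) * x = -(5 * c) ↔ -(5 * c) = 8 * x) :=
  atom_iff hp (cast_ne_zero hp h7 (k := 1) (by norm_num)) (A' := 8 * x) (B' := -(5 * c)) (by push_cast; ring) (by push_cast; ring)

/-- Point atom `8·x = 8·c` reduced by `8`. [folklore] -/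
private theorem atm_8_8p (hp : p.Prime) (h7 : 7 ≤ p) (c x : ZMod p) :
    ((8 : ZMod p) * x = 8 * c ↔ c = x) :=
  atom_iff hp (cast_ne_zero hp h7 (k := 8) (by norm_num)) (A' := x) (B' := c) (by push_cast; ring) (by push_cast; ring)

/-- Point atom `8·x = −8·c` reduced by `8`. [folklore] -/
private theorem atm_8_8n (hp : p.Prime) (h7 : 7 ≤ p) (c x : ZMod p) :
    ((8 : ZMod p) * x = -(8 * c) ↔ -c = x) :=
  atom_iff hp (cast_ne_zero hp h7 (k := 8) (by norm_num)) (A' := x) (B' := -c) (by push_cast; ring) (by push_cast; ring)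

/-- Point atom `8·x = 10·c` reduced by `2`. [folklore] -/
private theorem atm_8_10p (hp : p.Prime) (h7 : 7 ≤ p) (c x : ZMod p) :
    ((8 : ZMod p) * x = 10 * c ↔ 5 * c = 4 * x) :=
  atom_iff hp (cast_ne_zero hp h7 (k := 2) (by norm_num)) (A' := 4 * x) (B' := 5 * c) (by push_cast; ring) (by push_cast; ring)

/-- Point atom `8·x = −10·c` reduced by `2`. [folklore] -/
private theorem atm_8_10n (hp : p.Prime) (h7 : 7 ≤ p) (c x : ZMod p) :
    ((8 : ZMod p) * x = -(10 * c) ↔ -(5 * c) = 4 * x) :=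
  atom_iff hp (cast_ne_zero hp h7 (k := 2) (by norm_num)) (A' := 4 * x) (B' := -(5 * c)) (by push_cast; ring) (by push_cast; ring)

/-- Point atom `8·x = 20·c` reduced by `4`. [folklore] -/
private theorem atm_8_20p (hp : p.Prime) (h7 : 7 ≤ p) (c x : ZMod p) :
    ((8 : ZMod p) * x = 20 * c ↔ 5 * c = 2 * x) :=
  atom_iff hp (cast_ne_zero hp h7 (k := 4) (by norm_num)) (A' := 2 * x) (B' := 5 * c) (by push_cast; ring) (by push_cast; ring)

/-- Point atom `8·x = −20·c` reduced by `4`. [folklore] -/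
private theorem atm_8_20n (hp : p.Prime) (h7 : 7 ≤ p) (c x : ZMod p) :
    ((8 : ZMod p) * x = -(20 * c) ↔ -(5 * c) = 2 * x) :=
  atom_iff hp (cast_ne_zero hp h7 (k := 4) (by norm_num)) (A' := 2 * x) (B' := -(5 * c)) (by push_cast; ring) (by push_cast; ring)

/-- Point atom `8·x = 40·c` reduced by `8`. [folklore] -/
private theorem atm_8_40p (hp : p.Prime) (h7 : 7 ≤ p) (c x : ZMod p) :
    ((8 : ZMod p) * x = 40 * c ↔ 5 * c = x) :=
  atom_iff hp (cast_ne_zero hp h7 (k := 8) (by norm_num)) (A' := x) (B' := 5 * c) (by push_cast; ring) (by push_cast; ring)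

/-- Point atom `8·x = −40·c` reduced by `8`. [folklore] -/
private theorem atm_8_40n (hp : p.Prime) (h7 : 7 ≤ p) (c x : ZMod p) :
    ((8 : ZMod p) * x = -(40 * c) ↔ -(5 * c) = x) :=
  atom_iff hp (cast_ne_zero hp h7 (k := 8) (by norm_num)) (A' := x) (B' := -(5 * c)) (by push_cast; ring) (by push_cast; ring)

/-- Point atom `5·x = 1·c` reduced by `1`. [folklore] -/
private theorem atm_5_1p (hp : p.Prime) (h7 : 7 ≤ p) (c x : ZMod p) :
    ((5 : ZMod p) * x = c ↔ c = 5 * x) :=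
  atom_iff hp (cast_ne_zero hp h7 (k := 1) (by norm_num)) (A' := 5 * x) (B' := c) (by push_cast; ring) (by push_cast; ring)

/-- Point atom `5·x = −1·c` reduced by `1`. [folklore] -/
private theorem atm_5_1n (hp : p.Prime) (h7 : 7 ≤ p) (c x : ZMod p) :
    ((5 : ZMod p) * x = -c ↔ -c = 5 * x) :=
  atom_iff hp (cast_ne_zero hp h7 (k := 1) (by norm_num)) (A' := 5 * x) (B' := -c) (by push_cast; ring) (by push_cast; ring)

/-- Point atom `5·x = 2·c` reduced by `1`. [folklore] -/
private theorem atm_5_2p (hp : p.Prime) (h7 : 7 ≤ p) (c x : ZMod p) :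
    ((5 : ZMod p) * x = 2 * c ↔ 2 * c = 5 * x) :=
  atom_iff hp (cast_ne_zero hp h7 (k := 1) (by norm_num)) (A' := 5 * x) (B' := 2 * c) (by push_cast; ring) (by push_cast; ring)

/-- Point atom `5·x = −2·c` reduced by `1`. [folklore] -/
private theorem atm_5_2n (hp : p.Prime) (h7 : 7 ≤ p) (c x : ZMod p) :
    ((5 : ZMod p) * x = -(2 * c) ↔ -(2 * c) = 5 * x) :=
  atom_iff hp (cast_ne_zero hp h7 (k := 1) (by norm_num)) (A' := 5 * x) (B' := -(2 * c)) (by push_cast; ring) (by push_cast; ring)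

/-- Point atom `5·x = 4·c` reduced by `1`. [folklore] -/
private theorem atm_5_4p (hp : p.Prime) (h7 : 7 ≤ p) (c x : ZMod p) :
    ((5 : ZMod p) * x = 4 * c ↔ 4 * c = 5 * x) :=
  atom_iff hp (cast_ne_zero hp h7 (k := 1) (by norm_num)) (A' := 5 * x) (B' := 4 * c) (by push_cast; ring) (by push_cast; ring)

/-- Point atom `5·x = −4·c` reduced by `1`. [folklore] -/
private theorem atm_5_4n (hp : p.Prime) (h7 : 7 ≤ p) (c x : ZMod p) :
    ((5 : ZMod p) * x = -(4 * c) ↔ -(4 * c) = 5 * x) :=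
  atom_iff hp (cast_ne_zero hp h7 (k := 1) (by norm_num)) (A' := 5 * x) (B' := -(4 * c)) (by push_cast; ring) (by push_cast; ring)

/-- Point atom `5·x = 5·c` reduced by `5`. [folklore] -/
private theorem atm_5_5p (hp : p.Prime) (h7 : 7 ≤ p) (c x : ZMod p) :
    ((5 : ZMod p) * x = 5 * c ↔ c = x) :=
  atom_iff hp (cast_ne_zero hp h7 (k := 5) (by norm_num)) (A' := x) (B' := c) (by push_cast; ring) (by push_cast; ring)

/-- Point atom `5·x = −5·c` reduced by `5`. [folklore] -/
private theorem atm_5_5n (hp : p.Prime) (h7 : 7 ≤ p) (c x : ZMod p) :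
    ((5 : ZMod p) * x = -(5 * c) ↔ -c = x) :=
  atom_iff hp (cast_ne_zero hp h7 (k := 5) (by norm_num)) (A' := x) (B' := -c) (by push_cast; ring) (by push_cast; ring)

/-- Point atom `5·x = 8·c` reduced by `1`. [folklore] -/
private theorem atm_5_8p (hp : p.Prime) (h7 : 7 ≤ p) (c x : ZMod p) :
    ((5 : ZMod p) * x = 8 * c ↔ 8 * c = 5 * x) :=
  atom_iff hp (cast_ne_zero hp h7 (k := 1) (by norm_num)) (A' := 5 * x) (B' := 8 * c) (by push_cast; ring) (by push_cast; ring)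

/-- Point atom `5·x = −8·c` reduced by `1`. [folklore] -/
private theorem atm_5_8n (hp : p.Prime) (h7 : 7 ≤ p) (c x : ZMod p) :
    ((5 : ZMod p) * x = -(8 * c) ↔ -(8 * c) = 5 * x) :=
  atom_iff hp (cast_ne_zero hp h7 (k := 1) (by norm_num)) (A' := 5 * x) (B' := -(8 * c)) (by push_cast; ring) (by push_cast; ring)

/-- Point atom `5·x = 10·c` reduced by `5`. [folklore] -/
private theorem atm_5_10p (hp : p.Prime) (h7 : 7 ≤ p) (c x : ZMod p) :
    ((5 : ZMod p) * x = 10 * c ↔ 2 * c = x) :=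
  atom_iff hp (cast_ne_zero hp h7 (k := 5) (by norm_num)) (A' := x) (B' := 2 * c) (by push_cast; ring) (by push_cast; ring)

/-- Point atom `5·x = −10·c` reduced by `5`. [folklore] -/
private theorem atm_5_10n (hp : p.Prime) (h7 : 7 ≤ p) (c x : ZMod p) :
    ((5 : ZMod p) * x = -(10 * c) ↔ -(2 * c) = x) :=
  atom_iff hp (cast_ne_zero hp h7 (k := 5) (by norm_num)) (A' := x) (B' := -(2 * c)) (by push_cast; ring) (by push_cast; ring)

/-- Point atom `5·x = 20·c` reduced by `5`. [folklore] -/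
private theorem atm_5_20p (hp : p.Prime) (h7 : 7 ≤ p) (c x : ZMod p) :
    ((5 : ZMod p) * x = 20 * c ↔ 4 * c = x) :=
  atom_iff hp (cast_ne_zero hp h7 (k := 5) (by norm_num)) (A' := x) (B' := 4 * c) (by push_cast; ring) (by push_cast; ring)

/-- Point atom `5·x = −20·c` reduced by `5`. [folklore] -/
private theorem atm_5_20n (hp : p.Prime) (h7 : 7 ≤ p) (c x : ZMod p) :
    ((5 : ZMod p) * x = -(20 * c) ↔ -(4 * c) = x) :=
  atom_iff hp (cast_ne_zero hp h7 (k := 5) (by norm_num)) (A' := x) (B' := -(4 * c)) (by push_cast; ring) (by push_cast; ring)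

/-- Point atom `5·x = 40·c` reduced by `5`. [folklore] -/
private theorem atm_5_40p (hp : p.Prime) (h7 : 7 ≤ p) (c x : ZMod p) :
    ((5 : ZMod p) * x = 40 * c ↔ 8 * c = x) :=
  atom_iff hp (cast_ne_zero hp h7 (k := 5) (by norm_num)) (A' := x) (B' := 8 * c) (by push_cast; ring) (by push_cast; ring)

/-- Point atom `5·x = −40·c` reduced by `5`. [folklore] -/
private theorem atm_5_40n (hp : p.Prime) (h7 : 7 ≤ p) (c x : ZMod p) :
    ((5 : ZMod p) * x = -(40 * c) ↔ -(8 * c) = x) :=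
  atom_iff hp (cast_ne_zero hp h7 (k := 5) (by norm_num)) (A' := x) (B' := -(8 * c)) (by push_cast; ring) (by push_cast; ring)

/-- Point atom `4·x = 1·c` reduced by `1`. [folklore] -/
private theorem atm_4_1p (hp : p.Prime) (h7 : 7 ≤ p) (c x : ZMod p) :
    ((4 : ZMod p) * x = c ↔ c = 4 * x) :=
  atom_iff hp (cast_ne_zero hp h7 (k := 1) (by norm_num)) (A' := 4 * x) (B' := c) (by push_cast; ring) (by push_cast; ring)

/-- Point atom `4·x = −1·c` reduced by `1`. [folklore] -/
private theorem atm_4_1n (hp : p.Prime) (h7 : 7 ≤ p) (c x : ZMod p) :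
    ((4 : ZMod p) * x = -c ↔ -c = 4 * x) :=
  atom_iff hp (cast_ne_zero hp h7 (k := 1) (by norm_num)) (A' := 4 * x) (B' := -c) (by push_cast; ring) (by push_cast; ring)

/-- Point atom `4·x = 2·c` reduced by `2`. [folklore] -/
private theorem atm_4_2p (hp : p.Prime) (h7 : 7 ≤ p) (c x : ZMod p) :
    ((4 : ZMod p) * x = 2 * c ↔ c = 2 * x) :=
  atom_iff hp (cast_ne_zero hp h7 (k := 2) (by norm_num)) (A' := 2 * x) (B' := c) (by push_cast; ring) (by push_cast; ring)

/-- Point atom `4·x = −2·c` reduced by `2`. [folklore] -/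
private theorem atm_4_2n (hp : p.Prime) (h7 : 7 ≤ p) (c x : ZMod p) :
    ((4 : ZMod p) * x = -(2 * c) ↔ -c = 2 * x) :=
  atom_iff hp (cast_ne_zero hp h7 (k := 2) (by norm_num)) (A' := 2 * x) (B' := -c) (by push_cast; ring) (by push_cast; ring)

/-- Point atom `4·x = 4·c` reduced by `4`. [folklore] -/
private theorem atm_4_4p (hp : p.Prime) (h7 : 7 ≤ p) (c x : ZMod p) :
    ((4 : ZMod p) * x = 4 * c ↔ c = x) :=
  atom_iff hp (cast_ne_zero hp h7 (k := 4) (by norm_num)) (A' := x) (B' := c) (by push_cast; ring) (by push_cast; ring)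

/-- Point atom `4·x = −4·c` reduced by `4`. [folklore] -/
private theorem atm_4_4n (hp : p.Prime) (h7 : 7 ≤ p) (c x : ZMod p) :
    ((4 : ZMod p) * x = -(4 * c) ↔ -c = x) :=
  atom_iff hp (cast_ne_zero hp h7 (k := 4) (by norm_num)) (A' := x) (B' := -c) (by push_cast; ring) (by push_cast; ring)

/-- Point atom `4·x = 5·c` reduced by `1`. [folklore] -/
private theorem atm_4_5p (hp : p.Prime) (h7 : 7 ≤ p) (c x : ZMod p) :
    ((4 : ZMod p) * x = 5 * c ↔ 5 * c = 4 * x) :=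
  atom_iff hp (cast_ne_zero hp h7 (k := 1) (by norm_num)) (A' := 4 * x) (B' := 5 * c) (by push_cast; ring) (by push_cast; ring)

/-- Point atom `4·x = −5·c` reduced by `1`. [folklore] -/
private theorem atm_4_5n (hp : p.Prime) (h7 : 7 ≤ p) (c x : ZMod p) :
    ((4 : ZMod p) * x = -(5 * c) ↔ -(5 * c) = 4 * x) :=
  atom_iff hp (cast_ne_zero hp h7 (k := 1) (by norm_num)) (A' := 4 * x) (B' := -(5 * c)) (by push_cast; ring) (by push_cast; ring)

/-- Point atom `4·x = 8·c` reduced by `4`. [folklore] -/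
private theorem atm_4_8p (hp : p.Prime) (h7 : 7 ≤ p) (c x : ZMod p) :
    ((4 : ZMod p) * x = 8 * c ↔ 2 * c = x) :=
  atom_iff hp (cast_ne_zero hp h7 (k := 4) (by norm_num)) (A' := x) (B' := 2 * c) (by push_cast; ring) (by push_cast; ring)

/-- Point atom `4·x = −8·c` reduced by `4`. [folklore] -/
private theorem atm_4_8n (hp : p.Prime) (h7 : 7 ≤ p) (c x : ZMod p) :
    ((4 : ZMod p) * x = -(8 * c) ↔ -(2 * c) = x) :=
  atom_iff hp (cast_ne_zero hp h7 (k := 4) (by norm_num)) (A' := x) (B' := -(2 * c)) (by push_cast; ring) (by push_cast; ring)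

/-- Point atom `4·x = 10·c` reduced by `2`. [folklore] -/
private theorem atm_4_10p (hp : p.Prime) (h7 : 7 ≤ p) (c x : ZMod p) :
    ((4 : ZMod p) * x = 10 * c ↔ 5 * c = 2 * x) :=
  atom_iff hp (cast_ne_zero hp h7 (k := 2) (by norm_num)) (A' := 2 * x) (B' := 5 * c) (by push_cast; ring) (by push_cast; ring)

/-- Point atom `4·x = −10·c` reduced by `2`. [folklore] -/
private theorem atm_4_10n (hp : p.Prime) (h7 : 7 ≤ p) (c x : ZMod p) :
    ((4 : ZMod p) * x = -(10 * c) ↔ -(5 * c) = 2 * x) :=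
  atom_iff hp (cast_ne_zero hp h7 (k := 2) (by norm_num)) (A' := 2 * x) (B' := -(5 * c)) (by push_cast; ring) (by push_cast; ring)

/-- Point atom `4·x = 20·c` reduced by `4`. [folklore] -/
private theorem atm_4_20p (hp : p.Prime) (h7 : 7 ≤ p) (c x : ZMod p) :
    ((4 : ZMod p) * x = 20 * c ↔ 5 * c = x) :=
  atom_iff hp (cast_ne_zero hp h7 (k := 4) (by norm_num)) (A' := x) (B' := 5 * c) (by push_cast; ring) (by push_cast; ring)

/-- Point atom `4·x = −20·c` reduced by `4`. [folklore] -/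
private theorem atm_4_20n (hp : p.Prime) (h7 : 7 ≤ p) (c x : ZMod p) :
    ((4 : ZMod p) * x = -(20 * c) ↔ -(5 * c) = x) :=
  atom_iff hp (cast_ne_zero hp h7 (k := 4) (by norm_num)) (A' := x) (B' := -(5 * c)) (by push_cast; ring) (by push_cast; ring)

/-- Point atom `4·x = 40·c` reduced by `4`. [folklore] -/
private theorem atm_4_40p (hp : p.Prime) (h7 : 7 ≤ p) (c x : ZMod p) :
    ((4 : ZMod p) * x = 40 * c ↔ 10 * c = x) :=
  atom_iff hp (cast_ne_zero hp h7 (k := 4) (by norm_num)) (A' := x) (B' := 10 * c) (by push_cast; ring) (by push_cast; ring)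

/-- Point atom `4·x = −40·c` reduced by `4`. [folklore] -/
private theorem atm_4_40n (hp : p.Prime) (h7 : 7 ≤ p) (c x : ZMod p) :
    ((4 : ZMod p) * x = -(40 * c) ↔ -(10 * c) = x) :=
  atom_iff hp (cast_ne_zero hp h7 (k := 4) (by norm_num)) (A' := x) (B' := -(10 * c)) (by push_cast; ring) (by push_cast; ring)

/-- Point atom `2·x = 1·c` reduced by `1`. [folklore] -/
private theorem atm_2_1p (hp : p.Prime) (h7 : 7 ≤ p) (c x : ZMod p) :
    ((2 : ZMod p) * x = c ↔ c = 2 * x) :=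
  atom_iff hp (cast_ne_zero hp h7 (k := 1) (by norm_num)) (A' := 2 * x) (B' := c) (by push_cast; ring) (by push_cast; ring)

/-- Point atom `2·x = −1·c` reduced by `1`. [folklore] -/
private theorem atm_2_1n (hp : p.Prime) (h7 : 7 ≤ p) (c x : ZMod p) :
    ((2 : ZMod p) * x = -c ↔ -c = 2 * x) :=
  atom_iff hp (cast_ne_zero hp h7 (k := 1) (by norm_num)) (A' := 2 * x) (B' := -c) (by push_cast; ring) (by push_cast; ring)

/-- Point atom `2·x = 2·c` reduced by `2`. [folklore] -/
private theorem atm_2_2p (hp : p.Prime) (h7 : 7 ≤ p) (c x : ZMod p) :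
    ((2 : ZMod p) * x = 2 * c ↔ c = x) :=
  atom_iff hp (cast_ne_zero hp h7 (k := 2) (by norm_num)) (A' := x) (B' := c) (by push_cast; ring) (by push_cast; ring)

/-- Point atom `2·x = −2·c` reduced by `2`. [folklore] -/
private theorem atm_2_2n (hp : p.Prime) (h7 : 7 ≤ p) (c x : ZMod p) :
    ((2 : ZMod p) * x = -(2 * c) ↔ -c = x) :=
  atom_iff hp (cast_ne_zero hp h7 (k := 2) (by norm_num)) (A' := x) (B' := -c) (by push_cast; ring) (by push_cast; ring)

/-- Point atom `2·x = 4·c` reduced by `2`. [folklore] -/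
private theorem atm_2_4p (hp : p.Prime) (h7 : 7 ≤ p) (c x : ZMod p) :
    ((2 : ZMod p) * x = 4 * c ↔ 2 * c = x) :=
  atom_iff hp (cast_ne_zero hp h7 (k := 2) (by norm_num)) (A' := x) (B' := 2 * c) (by push_cast; ring) (by push_cast; ring)

/-- Point atom `2·x = −4·c` reduced by `2`. [folklore] -/
private theorem atm_2_4n (hp : p.Prime) (h7 : 7 ≤ p) (c x : ZMod p) :
    ((2 : ZMod p) * x = -(4 * c) ↔ -(2 * c) = x) :=
  atom_iff hp (cast_ne_zero hp h7 (k := 2) (by norm_num)) (A' := x) (B' := -(2 * c)) (by push_cast; ring) (by push_cast; ring)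

/-- Point atom `2·x = 5·c` reduced by `1`. [folklore] -/
private theorem atm_2_5p (hp : p.Prime) (h7 : 7 ≤ p) (c x : ZMod p) :
    ((2 : ZMod p) * x = 5 * c ↔ 5 * c = 2 * x) :=
  atom_iff hp (cast_ne_zero hp h7 (k := 1) (by norm_num)) (A' := 2 * x) (B' := 5 * c) (by push_cast; ring) (by push_cast; ring)

/-- Point atom `2·x = −5·c` reduced by `1`. [folklore] -/
private theorem atm_2_5n (hp : p.Prime) (h7 : 7 ≤ p) (c x : ZMod p) :
    ((2 : ZMod p) * x = -(5 * c) ↔ -(5 * c) = 2 * x) :=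
  atom_iff hp (cast_ne_zero hp h7 (k := 1) (by norm_num)) (A' := 2 * x) (B' := -(5 * c)) (by push_cast; ring) (by push_cast; ring)

/-- Point atom `2·x = 8·c` reduced by `2`. [folklore] -/
private theorem atm_2_8p (hp : p.Prime) (h7 : 7 ≤ p) (c x : ZMod p) :
    ((2 : ZMod p) * x = 8 * c ↔ 4 * c = x) :=
  atom_iff hp (cast_ne_zero hp h7 (k := 2) (by norm_num)) (A' := x) (B' := 4 * c) (by push_cast; ring) (by push_cast; ring)

/-- Point atom `2·x = −8·c` reduced by `2`. [folklore] -/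
private theorem atm_2_8n (hp : p.Prime) (h7 : 7 ≤ p) (c x : ZMod p) :
    ((2 : ZMod p) * x = -(8 * c) ↔ -(4 * c) = x) :=
  atom_iff hp (cast_ne_zero hp h7 (k := 2) (by norm_num)) (A' := x) (B' := -(4 * c)) (by push_cast; ring) (by push_cast; ring)

/-- Point atom `2·x = 10·c` reduced by `2`. [folklore] -/
private theorem atm_2_10p (hp : p.Prime) (h7 : 7 ≤ p) (c x : ZMod p) :
    ((2 : ZMod p) * x = 10 * c ↔ 5 * c = x) :=
  atom_iff hp (cast_ne_zero hp h7 (k := 2) (by norm_num)) (A' := x) (B' := 5 * c) (by push_cast; ring) (by push_cast; ring)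

/-- Point atom `2·x = −10·c` reduced by `2`. [folklore] -/
private theorem atm_2_10n (hp : p.Prime) (h7 : 7 ≤ p) (c x : ZMod p) :
    ((2 : ZMod p) * x = -(10 * c) ↔ -(5 * c) = x) :=
  atom_iff hp (cast_ne_zero hp h7 (k := 2) (by norm_num)) (A' := x) (B' := -(5 * c)) (by push_cast; ring) (by push_cast; ring)

/-- Point atom `2·x = 20·c` reduced by `2`. [folklore] -/
private theorem atm_2_20p (hp : p.Prime) (h7 : 7 ≤ p) (c x : ZMod p) :
    ((2 : ZMod p) * x = 20 * c ↔ 10 * c = x) :=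
  atom_iff hp (cast_ne_zero hp h7 (k := 2) (by norm_num)) (A' := x) (B' := 10 * c) (by push_cast; ring) (by push_cast; ring)

/-- Point atom `2·x = −20·c` reduced by `2`. [folklore] -/
private theorem atm_2_20n (hp : p.Prime) (h7 : 7 ≤ p) (c x : ZMod p) :
    ((2 : ZMod p) * x = -(20 * c) ↔ -(10 * c) = x) :=
  atom_iff hp (cast_ne_zero hp h7 (k := 2) (by norm_num)) (A' := x) (B' := -(10 * c)) (by push_cast; ring) (by push_cast; ring)

/-- Point atom `2·x = 40·c` reduced by `2`. [folklore] -/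
private theorem atm_2_40p (hp : p.Prime) (h7 : 7 ≤ p) (c x : ZMod p) :
    ((2 : ZMod p) * x = 40 * c ↔ 20 * c = x) :=
  atom_iff hp (cast_ne_zero hp h7 (k := 2) (by norm_num)) (A' := x) (B' := 20 * c) (by push_cast; ring) (by push_cast; ring)

/-- Point atom `2·x = −40·c` reduced by `2`. [folklore] -/
private theorem atm_2_40n (hp : p.Prime) (h7 : 7 ≤ p) (c x : ZMod p) :
    ((2 : ZMod p) * x = -(40 * c) ↔ -(20 * c) = x) :=
  atom_iff hp (cast_ne_zero hp h7 (k := 2) (by norm_num)) (A' := x) (B' := -(20 * c)) (by push_cast; ring) (by push_cast; ring)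

/-- All one hundred and twelve point atoms, bundled for the `simp` sets below. [folklore] -/
private theorem atoms (hp : p.Prime) (h7 : 7 ≤ p) (c x : ZMod p) :
    ((40 : ZMod p) * x = c ↔ c = 40 * x) ∧
    ((40 : ZMod p) * x = -c ↔ -c = 40 * x) ∧
    ((40 : ZMod p) * x = 2 * c ↔ c = 20 * x) ∧
    ((40 : ZMod p) * x = -(2 * c) ↔ -c = 20 * x) ∧
    ((40 : ZMod p) * x = 4 * c ↔ c = 10 * x) ∧
    ((40 : ZMod p) * x = -(4 * c) ↔ -c = 10 * x) ∧
    ((40 : ZMod p) * x = 5 * c ↔ c = 8 * x) ∧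
    ((40 : ZMod p) * x = -(5 * c) ↔ -c = 8 * x) ∧
    ((40 : ZMod p) * x = 8 * c ↔ c = 5 * x) ∧
    ((40 : ZMod p) * x = -(8 * c) ↔ -c = 5 * x) ∧
    ((40 : ZMod p) * x = 10 * c ↔ c = 4 * x) ∧
    ((40 : ZMod p) * x = -(10 * c) ↔ -c = 4 * x) ∧
    ((40 : ZMod p) * x = 20 * c ↔ c = 2 * x) ∧
    ((40 : ZMod p) * x = -(20 * c) ↔ -c = 2 * x) ∧
    ((40 : ZMod p) * x = 40 * c ↔ c = x) ∧
    ((40 : ZMod p) * x = -(40 * c) ↔ -c = x) ∧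
    ((20 : ZMod p) * x = c ↔ c = 20 * x) ∧
    ((20 : ZMod p) * x = -c ↔ -c = 20 * x) ∧
    ((20 : ZMod p) * x = 2 * c ↔ c = 10 * x) ∧
    ((20 : ZMod p) * x = -(2 * c) ↔ -c = 10 * x) ∧
    ((20 : ZMod p) * x = 4 * c ↔ c = 5 * x) ∧
    ((20 : ZMod p) * x = -(4 * c) ↔ -c = 5 * x) ∧
    ((20 : ZMod p) * x = 5 * c ↔ c = 4 * x) ∧
    ((20 : ZMod p) * x = -(5 * c) ↔ -c = 4 * x) ∧
    ((20 : ZMod p) * x = 8 * c ↔ 2 * c = 5 * x) ∧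
    ((20 : ZMod p) * x = -(8 * c) ↔ -(2 * c) = 5 * x) ∧
    ((20 : ZMod p) * x = 10 * c ↔ c = 2 * x) ∧
    ((20 : ZMod p) * x = -(10 * c) ↔ -c = 2 * x) ∧
    ((20 : ZMod p) * x = 20 * c ↔ c = x) ∧
    ((20 : ZMod p) * x = -(20 * c) ↔ -c = x) ∧
    ((20 : ZMod p) * x = 40 * c ↔ 2 * c = x) ∧
    ((20 : ZMod p) * x = -(40 * c) ↔ -(2 * c) = x) ∧
    ((10 : ZMod p) * x = c ↔ c = 10 * x) ∧
    ((10 : ZMod p) * x = -c ↔ -c = 10 * x) ∧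
    ((10 : ZMod p) * x = 2 * c ↔ c = 5 * x) ∧
    ((10 : ZMod p) * x = -(2 * c) ↔ -c = 5 * x) ∧
    ((10 : ZMod p) * x = 4 * c ↔ 2 * c = 5 * x) ∧
    ((10 : ZMod p) * x = -(4 * c) ↔ -(2 * c) = 5 * x) ∧
    ((10 : ZMod p) * x = 5 * c ↔ c = 2 * x) ∧
    ((10 : ZMod p) * x = -(5 * c) ↔ -c = 2 * x) ∧
    ((10 : ZMod p) * x = 8 * c ↔ 4 * c = 5 * x) ∧
    ((10 : ZMod p) * x = -(8 * c) ↔ -(4 * c) = 5 * x) ∧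
    ((10 : ZMod p) * x = 10 * c ↔ c = x) ∧
    ((10 : ZMod p) * x = -(10 * c) ↔ -c = x) ∧
    ((10 : ZMod p) * x = 20 * c ↔ 2 * c = x) ∧
    ((10 : ZMod p) * x = -(20 * c) ↔ -(2 * c) = x) ∧
    ((10 : ZMod p) * x = 40 * c ↔ 4 * c = x) ∧
    ((10 : ZMod p) * x = -(40 * c) ↔ -(4 * c) = x) ∧
    ((8 : ZMod p) * x = c ↔ c = 8 * x) ∧
    ((8 : ZMod p) * x = -c ↔ -c = 8 * x) ∧
    ((8 : ZMod p) * x = 2 * c ↔ c = 4 * x) ∧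
    ((8 : ZMod p) * x = -(2 * c) ↔ -c = 4 * x) ∧
    ((8 : ZMod p) * x = 4 * c ↔ c = 2 * x) ∧
    ((8 : ZMod p) * x = -(4 * c) ↔ -c = 2 * x) ∧
    ((8 : ZMod p) * x = 5 * c ↔ 5 * c = 8 * x) ∧
    ((8 : ZMod p) * x = -(5 * c) ↔ -(5 * c) = 8 * x) ∧
    ((8 : ZMod p) * x = 8 * c ↔ c = x) ∧
    ((8 : ZMod p) * x = -(8 * c) ↔ -c = x) ∧
    ((8 : ZMod p) * x = 10 * c ↔ 5 * c = 4 * x) ∧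
    ((8 : ZMod p) * x = -(10 * c) ↔ -(5 * c) = 4 * x) ∧
    ((8 : ZMod p) * x = 20 * c ↔ 5 * c = 2 * x) ∧
    ((8 : ZMod p) * x = -(20 * c) ↔ -(5 * c) = 2 * x) ∧
    ((8 : ZMod p) * x = 40 * c ↔ 5 * c = x) ∧
    ((8 : ZMod p) * x = -(40 * c) ↔ -(5 * c) = x) ∧
    ((5 : ZMod p) * x = c ↔ c = 5 * x) ∧
    ((5 : ZMod p) * x = -c ↔ -c = 5 * x) ∧
    ((5 : ZMod p) * x = 2 * c ↔ 2 * c = 5 * x) ∧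
    ((5 : ZMod p) * x = -(2 * c) ↔ -(2 * c) = 5 * x) ∧
    ((5 : ZMod p) * x = 4 * c ↔ 4 * c = 5 * x) ∧
    ((5 : ZMod p) * x = -(4 * c) ↔ -(4 * c) = 5 * x) ∧
    ((5 : ZMod p) * x = 5 * c ↔ c = x) ∧
    ((5 : ZMod p) * x = -(5 * c) ↔ -c = x) ∧
    ((5 : ZMod p) * x = 8 * c ↔ 8 * c = 5 * x) ∧
    ((5 : ZMod p) * x = -(8 * c) ↔ -(8 * c) = 5 * x) ∧
    ((5 : ZMod p) * x = 10 * c ↔ 2 * c = x) ∧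
    ((5 : ZMod p) * x = -(10 * c) ↔ -(2 * c) = x) ∧
    ((5 : ZMod p) * x = 20 * c ↔ 4 * c = x) ∧
    ((5 : ZMod p) * x = -(20 * c) ↔ -(4 * c) = x) ∧
    ((5 : ZMod p) * x = 40 * c ↔ 8 * c = x) ∧
    ((5 : ZMod p) * x = -(40 * c) ↔ -(8 * c) = x) ∧
    ((4 : ZMod p) * x = c ↔ c = 4 * x) ∧
    ((4 : ZMod p) * x = -c ↔ -c = 4 * x) ∧
    ((4 : ZMod p) * x = 2 * c ↔ c = 2 * x) ∧
    ((4 : ZMod p) * x = -(2 * c) ↔ -c = 2 * x) ∧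
    ((4 : ZMod p) * x = 4 * c ↔ c = x) ∧
    ((4 : ZMod p) * x = -(4 * c) ↔ -c = x) ∧
    ((4 : ZMod p) * x = 5 * c ↔ 5 * c = 4 * x) ∧
    ((4 : ZMod p) * x = -(5 * c) ↔ -(5 * c) = 4 * x) ∧
    ((4 : ZMod p) * x = 8 * c ↔ 2 * c = x) ∧
    ((4 : ZMod p) * x = -(8 * c) ↔ -(2 * c) = x) ∧
    ((4 : ZMod p) * x = 10 * c ↔ 5 * c = 2 * x) ∧
    ((4 : ZMod p) * x = -(10 * c) ↔ -(5 * c) = 2 * x) ∧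
    ((4 : ZMod p) * x = 20 * c ↔ 5 * c = x) ∧
    ((4 : ZMod p) * x = -(20 * c) ↔ -(5 * c) = x) ∧
    ((4 : ZMod p) * x = 40 * c ↔ 10 * c = x) ∧
    ((4 : ZMod p) * x = -(40 * c) ↔ -(10 * c) = x) ∧
    ((2 : ZMod p) * x = c ↔ c = 2 * x) ∧
    ((2 : ZMod p) * x = -c ↔ -c = 2 * x) ∧
    ((2 : ZMod p) * x = 2 * c ↔ c = x) ∧
    ((2 : ZMod p) * x = -(2 * c) ↔ -c = x) ∧
    ((2 : ZMod p) * x = 4 * c ↔ 2 * c = x) ∧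
    ((2 : ZMod p) * x = -(4 * c) ↔ -(2 * c) = x) ∧
    ((2 : ZMod p) * x = 5 * c ↔ 5 * c = 2 * x) ∧
    ((2 : ZMod p) * x = -(5 * c) ↔ -(5 * c) = 2 * x) ∧
    ((2 : ZMod p) * x = 8 * c ↔ 4 * c = x) ∧
    ((2 : ZMod p) * x = -(8 * c) ↔ -(4 * c) = x) ∧
    ((2 : ZMod p) * x = 10 * c ↔ 5 * c = x) ∧
    ((2 : ZMod p) * x = -(10 * c) ↔ -(5 * c) = x) ∧
    ((2 : ZMod p) * x = 20 * c ↔ 10 * c = x) ∧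
    ((2 : ZMod p) * x = -(20 * c) ↔ -(10 * c) = x) ∧
    ((2 : ZMod p) * x = 40 * c ↔ 20 * c = x) ∧
    ((2 : ZMod p) * x = -(40 * c) ↔ -(20 * c) = x) :=
  ⟨atm_40_1p hp h7 c x, atm_40_1n hp h7 c x, atm_40_2p hp h7 c x, atm_40_2n hp h7 c x, atm_40_4p hp h7 c x,
    atm_40_4n hp h7 c x, atm_40_5p hp h7 c x, atm_40_5n hp h7 c x, atm_40_8p hp h7 c x, atm_40_8n hp h7 c x,
    atm_40_10p hp h7 c x, atm_40_10n hp h7 c x, atm_40_20p hp h7 c x, atm_40_20n hp h7 c x, atm_40_40p hp h7 c x,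
    atm_40_40n hp h7 c x, atm_20_1p hp h7 c x, atm_20_1n hp h7 c x, atm_20_2p hp h7 c x, atm_20_2n hp h7 c x,
    atm_20_4p hp h7 c x, atm_20_4n hp h7 c x, atm_20_5p hp h7 c x, atm_20_5n hp h7 c x, atm_20_8p hp h7 c x,
    atm_20_8n hp h7 c x, atm_20_10p hp h7 c x, atm_20_10n hp h7 c x, atm_20_20p hp h7 c x, atm_20_20n hp h7 c x,
    atm_20_40p hp h7 c x, atm_20_40n hp h7 c x, atm_10_1p hp h7 c x, atm_10_1n hp h7 c x, atm_10_2p hp h7 c x,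
    atm_10_2n hp h7 c x, atm_10_4p hp h7 c x, atm_10_4n hp h7 c x, atm_10_5p hp h7 c x, atm_10_5n hp h7 c x,
    atm_10_8p hp h7 c x, atm_10_8n hp h7 c x, atm_10_10p hp h7 c x, atm_10_10n hp h7 c x, atm_10_20p hp h7 c x,
    atm_10_20n hp h7 c x, atm_10_40p hp h7 c x, atm_10_40n hp h7 c x, atm_8_1p hp h7 c x, atm_8_1n hp h7 c x,
    atm_8_2p hp h7 c x, atm_8_2n hp h7 c x, atm_8_4p hp h7 c x, atm_8_4n hp h7 c x, atm_8_5p hp h7 c x, atm_8_5n hp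
    h7 c x, atm_8_8p hp h7 c x, atm_8_8n hp h7 c x, atm_8_10p hp h7 c x, atm_8_10n hp h7 c x, atm_8_20p hp h7 c x,
    atm_8_20n hp h7 c x, atm_8_40p hp h7 c x, atm_8_40n hp h7 c x, atm_5_1p hp h7 c x, atm_5_1n hp h7 c x, atm_5_2p
    hp h7 c x, atm_5_2n hp h7 c x, atm_5_4p hp h7 c x, atm_5_4n hp h7 c x, atm_5_5p hp h7 c x, atm_5_5n hp h7 c x,
    atm_5_8p hp h7 c x, atm_5_8n hp h7 c x, atm_5_10p hp h7 c x, atm_5_10n hp h7 c x, atm_5_20p hp h7 c x, atm_5_20n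
    hp h7 c x, atm_5_40p hp h7 c x, atm_5_40n hp h7 c x, atm_4_1p hp h7 c x, atm_4_1n hp h7 c x, atm_4_2p hp h7 c x,
    atm_4_2n hp h7 c x, atm_4_4p hp h7 c x, atm_4_4n hp h7 c x, atm_4_5p hp h7 c x, atm_4_5n hp h7 c x, atm_4_8p hp
    h7 c x, atm_4_8n hp h7 c x, atm_4_10p hp h7 c x, atm_4_10n hp h7 c x, atm_4_20p hp h7 c x, atm_4_20n hp h7 c x,
    atm_4_40p hp h7 c x, atm_4_40n hp h7 c x, atm_2_1p hp h7 c x, atm_2_1n hp h7 c x, atm_2_2p hp h7 c x, atm_2_2n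
    hp h7 c x, atm_2_4p hp h7 c x, atm_2_4n hp h7 c x, atm_2_5p hp h7 c x, atm_2_5n hp h7 c x, atm_2_8p hp h7 c x,
    atm_2_8n hp h7 c x, atm_2_10p hp h7 c x, atm_2_10n hp h7 c x, atm_2_20p hp h7 c x, atm_2_20n hp h7 c x,
    atm_2_40p hp h7 c x, atm_2_40n hp h7 c x⟩

/-- `2c, 4c, 5c, 8c, 10c, 20c, 40c ≠ 0` for `c ≠ 0` in `ℤ/p`, `p ≥ 7` prime. [folklore] -/
private theorem mul_ne_zero_facts (hp : p.Prime) (h7 : 7 ≤ p) {c : ZMod p} (hc : c ≠ 0) :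
    (2 * c ≠ 0) ∧ (4 * c ≠ 0) ∧ (5 * c ≠ 0) ∧ (8 * c ≠ 0) ∧ (10 * c ≠ 0) ∧ (20 * c ≠ 0) ∧ (40 * c ≠ 0) := by
  haveI := Fact.mk hp
  refine ⟨?_, ?_, ?_, ?_, ?_, ?_, ?_⟩
  · exact_mod_cast mul_ne_zero (cast_ne_zero hp h7 (k := 2) (by norm_num)) hc
  · exact_mod_cast mul_ne_zero (cast_ne_zero hp h7 (k := 4) (by norm_num)) hc
  · exact_mod_cast mul_ne_zero (cast_ne_zero hp h7 (k := 5) (by norm_num)) hc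
  · exact_mod_cast mul_ne_zero (cast_ne_zero hp h7 (k := 8) (by norm_num)) hc
  · exact_mod_cast mul_ne_zero (cast_ne_zero hp h7 (k := 10) (by norm_num)) hc
  · exact_mod_cast mul_ne_zero (cast_ne_zero hp h7 (k := 20) (by norm_num)) hc
  · exact_mod_cast mul_ne_zero (cast_ne_zero hp h7 (k := 40) (by norm_num)) hc

/-! ### The four functionals of level `40p` -/

/-- `ĝ(w) = g(w) − g(−w)`: twice the odd part. [folklore] -/
private def hat (g : ZMod (40 * p) → ℚ) (w : ZMod (40 * p)) : ℚ := g w - g (-w)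

/-- **`Z_R(c) = ĝ(1,c) − ĝ(9,c) + ĝ(11,c) − ĝ(19,c) − ĝ(21,c) + ĝ(29,c) − ĝ(31,c) + ĝ(39,c)`** (`χ₋₈ω^{±1}`, even, conductor `40`, real part; one fibre). [folklore] -/
private def ZR (h : Nat.Coprime 40 p) (g : ZMod (40 * p) → ℚ) (c : ZMod p) : ℚ :=
  hat g (pt h 1 c) - hat g (pt h 9 c) + hat g (pt h 11 c) - hat g (pt h 19 c) - hat g (pt h 21 c) + hat g (pt h 29
    c) - hat g (pt h 31 c) + hat g (pt h 39 c)

/-- **`Z_I(c) = −ĝ(3,c) − ĝ(7,c) + ĝ(13,c) + ĝ(17,c) + ĝ(23,c) + ĝ(27,c) − ĝ(33,c) − ĝ(37,c)`** (imaginary part; one fibre). [folklore] -/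
private def ZI (h : Nat.Coprime 40 p) (g : ZMod (40 * p) → ℚ) (c : ZMod p) : ℚ :=
  -hat g (pt h 3 c) - hat g (pt h 7 c) + hat g (pt h 13 c) + hat g (pt h 17 c) + hat g (pt h 23 c) + hat g (pt h 27
    c) - hat g (pt h 33 c) - hat g (pt h 37 c)

/-- **`E₈(c) = Σ_{u∈U} χ₈(u)(ĝ(u,c) + ĝ(u,5c)) + 4 Σ_{v∈F} χ₈(v/5) ĝ(v,5c)`** (`χ₈`, even, conductor `8`; fibres `c, 5c`). [folklore] -/
private def E8 (h : Nat.Coprime 40 p) (g : ZMod (40 * p) → ℚ) (c : ZMod p) : ℚ :=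
  hat g (pt h 1 c) - hat g (pt h 3 c) + hat g (pt h 7 c) + hat g (pt h 9 c) - hat g (pt h 11 c) - hat g (pt h 13 c)
    + hat g (pt h 17 c) - hat g (pt h 19 c) - hat g (pt h 21 c) + hat g (pt h 23 c) - hat g (pt h 27 c) - hat g (pt
    h 29 c) + hat g (pt h 31 c) + hat g (pt h 33 c) - hat g (pt h 37 c) + hat g (pt h 39 c) + hat g (pt h 1 (5 * c))
    - hat g (pt h 3 (5 * c)) + hat g (pt h 7 (5 * c)) + hat g (pt h 9 (5 * c)) - hat g (pt h 11 (5 * c)) - hat g (pt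
    h 13 (5 * c)) + hat g (pt h 17 (5 * c)) - hat g (pt h 19 (5 * c)) - hat g (pt h 21 (5 * c)) + hat g (pt h 23 (5
    * c)) - hat g (pt h 27 (5 * c)) - hat g (pt h 29 (5 * c)) + hat g (pt h 31 (5 * c)) + hat g (pt h 33 (5 * c)) -
    hat g (pt h 37 (5 * c)) + hat g (pt h 39 (5 * c)) + hat g (pt h 5 (5 * c)) + hat g (pt h 5 (5 * c)) + hat g (pt
    h 5 (5 * c)) + hat g (pt h 5 (5 * c)) - hat g (pt h 15 (5 * c)) - hat g (pt h 15 (5 * c)) - hat g (pt h 15 (5 *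
    c)) - hat g (pt h 15 (5 * c)) - hat g (pt h 25 (5 * c)) - hat g (pt h 25 (5 * c)) - hat g (pt h 25 (5 * c)) -
    hat g (pt h 25 (5 * c)) + hat g (pt h 35 (5 * c)) + hat g (pt h 35 (5 * c)) + hat g (pt h 35 (5 * c)) + hat g
    (pt h 35 (5 * c))

/-- **`Γ₋₈(c)`** (`χ₋₈`, odd, conductor `8`, even `ψ`; fibres `c, 5c`; constant in `c`). [folklore] -/
private def G8 (h : Nat.Coprime 40 p) (g : ZMod (40 * p) → ℚ) (c : ZMod p) : ℚ :=
  -hat g (pt h 1 c) - hat g (pt h 3 c) + hat g (pt h 7 c) - hat g (pt h 9 c) - hat g (pt h 11 c) + hat g (pt h 13 c)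
    - hat g (pt h 17 c) - hat g (pt h 19 c) + hat g (pt h 21 c) + hat g (pt h 23 c) - hat g (pt h 27 c) + hat g (pt
    h 29 c) + hat g (pt h 31 c) - hat g (pt h 33 c) + hat g (pt h 37 c) + hat g (pt h 39 c) - hat g (pt h 1 (5 * c))
    - hat g (pt h 3 (5 * c)) + hat g (pt h 7 (5 * c)) - hat g (pt h 9 (5 * c)) - hat g (pt h 11 (5 * c)) + hat g (pt
    h 13 (5 * c)) - hat g (pt h 17 (5 * c)) - hat g (pt h 19 (5 * c)) + hat g (pt h 21 (5 * c)) + hat g (pt h 23 (5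
    * c)) - hat g (pt h 27 (5 * c)) + hat g (pt h 29 (5 * c)) + hat g (pt h 31 (5 * c)) - hat g (pt h 33 (5 * c)) +
    hat g (pt h 37 (5 * c)) + hat g (pt h 39 (5 * c)) - hat g (pt h 5 (5 * c)) - hat g (pt h 5 (5 * c)) - hat g (pt
    h 5 (5 * c)) - hat g (pt h 5 (5 * c)) - hat g (pt h 15 (5 * c)) - hat g (pt h 15 (5 * c)) - hat g (pt h 15 (5 *
    c)) - hat g (pt h 15 (5 * c)) + hat g (pt h 25 (5 * c)) + hat g (pt h 25 (5 * c)) + hat g (pt h 25 (5 * c)) +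
    hat g (pt h 25 (5 * c)) + hat g (pt h 35 (5 * c)) + hat g (pt h 35 (5 * c)) + hat g (pt h 35 (5 * c)) + hat g
    (pt h 35 (5 * c))

/-- The difference `G8(c) − G8(c′)` (the relation is `= 0` for `c, c′ ≠ 0`). [folklore] -/
private def L8 (h : Nat.Coprime 40 p) (g : ZMod (40 * p) → ℚ) (c c' : ZMod p) : ℚ := G8 h g c - G8 h g c'

/-- `ĝ` is additive. [folklore] -/
private theorem hat_add (g g' : ZMod (40 * p) → ℚ) (w : ZMod (40 * p)) :
    hat (fun z ↦ g z + g' z) w = hat g w + hat g' w := by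
  simp only [hat]; ring

/-- `ĝ` is homogeneous. [folklore] -/
private theorem hat_smul (a : ℚ) (g : ZMod (40 * p) → ℚ) (w : ZMod (40 * p)) :
    hat (fun z ↦ a * g z) w = a * hat g w := by
  simp only [hat]; ring

/-- `ĝ` commutes with sums. [folklore] -/
private theorem hat_sum {ι : Type} (t : Finset ι) (g : ι → ZMod (40 * p) → ℚ) (w : ZMod (40 * p)) :
    hat (fun z ↦ ∑ i ∈ t, g i z) w = ∑ i ∈ t, hat (g i) w := by
  simp only [hat, Finset.sum_sub_distrib]

/-- `ĝ = 0` for negation-invariant `g`. [folklore] -/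
private theorem hat_even {g : ZMod (40 * p) → ℚ} (hg : ∀ z, g (-z) = g z) (w : ZMod (40 * p)) : hat g w = 0 := by
  simp only [hat, hg, sub_self]

/-- `ZR` is linear and kills negation-invariant functions. [folklore] -/
private theorem ZR_linear (h : Nat.Coprime 40 p) (c : ZMod p) :
    (∀ g g' : ZMod (40 * p) → ℚ, ZR h (fun z ↦ g z + g' z) c = ZR h g c + ZR h g' c) ∧
    (∀ (a : ℚ) (g : ZMod (40 * p) → ℚ), ZR h (fun z ↦ a * g z) c = a * ZR h g c) ∧
    (∀ {ι : Type} (t : Finset ι) (g : ι → ZMod (40 * p) → ℚ),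
      ZR h (fun z ↦ ∑ i ∈ t, g i z) c = ∑ i ∈ t, ZR h (g i) c) ∧
    (∀ g : ZMod (40 * p) → ℚ, (∀ z, g (-z) = g z) → ZR h g c = 0) := by
  refine ⟨fun g g' ↦ ?_, fun a g ↦ ?_, fun t g ↦ ?_, fun g hg ↦ ?_⟩
  · simp only [ZR, hat_add]; ring
  · simp only [ZR, hat_smul]; ring
  · simp only [ZR, hat_sum, ← Finset.sum_add_distrib, ← Finset.sum_sub_distrib, ← Finset.sum_neg_distrib]
  · simp only [ZR, hat_even hg]; ring

/-- `ZI` is linear and kills negation-invariant functions. [folklore] -/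
private theorem ZI_linear (h : Nat.Coprime 40 p) (c : ZMod p) :
    (∀ g g' : ZMod (40 * p) → ℚ, ZI h (fun z ↦ g z + g' z) c = ZI h g c + ZI h g' c) ∧
    (∀ (a : ℚ) (g : ZMod (40 * p) → ℚ), ZI h (fun z ↦ a * g z) c = a * ZI h g c) ∧
    (∀ {ι : Type} (t : Finset ι) (g : ι → ZMod (40 * p) → ℚ),
      ZI h (fun z ↦ ∑ i ∈ t, g i z) c = ∑ i ∈ t, ZI h (g i) c) ∧
    (∀ g : ZMod (40 * p) → ℚ, (∀ z, g (-z) = g z) → ZI h g c = 0) := by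
  refine ⟨fun g g' ↦ ?_, fun a g ↦ ?_, fun t g ↦ ?_, fun g hg ↦ ?_⟩
  · simp only [ZI, hat_add]; ring
  · simp only [ZI, hat_smul]; ring
  · simp only [ZI, hat_sum, ← Finset.sum_add_distrib, ← Finset.sum_sub_distrib, ← Finset.sum_neg_distrib]
  · simp only [ZI, hat_even hg]; ring

/-- `E8` is linear and kills negation-invariant functions. [folklore] -/
private theorem E8_linear (h : Nat.Coprime 40 p) (c : ZMod p) :
    (∀ g g' : ZMod (40 * p) → ℚ, E8 h (fun z ↦ g z + g' z) c = E8 h g c + E8 h g' c) ∧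
    (∀ (a : ℚ) (g : ZMod (40 * p) → ℚ), E8 h (fun z ↦ a * g z) c = a * E8 h g c) ∧
    (∀ {ι : Type} (t : Finset ι) (g : ι → ZMod (40 * p) → ℚ),
      E8 h (fun z ↦ ∑ i ∈ t, g i z) c = ∑ i ∈ t, E8 h (g i) c) ∧
    (∀ g : ZMod (40 * p) → ℚ, (∀ z, g (-z) = g z) → E8 h g c = 0) := by
  refine ⟨fun g g' ↦ ?_, fun a g ↦ ?_, fun t g ↦ ?_, fun g hg ↦ ?_⟩
  · simp only [E8, hat_add]; ring
  · simp only [E8, hat_smul]; ring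
  · simp only [E8, hat_sum, ← Finset.sum_add_distrib, ← Finset.sum_sub_distrib, ← Finset.sum_neg_distrib]
  · simp only [E8, hat_even hg]; ring

/-- `L8` is linear and kills negation-invariant functions. [folklore] -/
private theorem L8_linear (h : Nat.Coprime 40 p) (c c' : ZMod p) :
    (∀ g g' : ZMod (40 * p) → ℚ, L8 h (fun z ↦ g z + g' z) c c' = L8 h g c c' + L8 h g' c c') ∧
    (∀ (a : ℚ) (g : ZMod (40 * p) → ℚ), L8 h (fun z ↦ a * g z) c c' = a * L8 h g c c') ∧
    (∀ {ι : Type} (t : Finset ι) (g : ι → ZMod (40 * p) → ℚ),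
      L8 h (fun z ↦ ∑ i ∈ t, g i z) c c' = ∑ i ∈ t, L8 h (g i) c c') ∧
    (∀ g : ZMod (40 * p) → ℚ, (∀ z, g (-z) = g z) → L8 h g c c' = 0) := by
  refine ⟨fun g g' ↦ ?_, fun a g ↦ ?_, fun t g ↦ ?_, fun g hg ↦ ?_⟩
  · simp only [L8, G8, hat_add]; ring
  · simp only [L8, G8, hat_smul]; ring
  · simp only [L8, G8, hat_sum, ← Finset.sum_add_distrib, ← Finset.sum_sub_distrib, ← Finset.sum_neg_distrib]
  · simp only [L8, G8, hat_even hg]; ring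

/-! ### The functionals kill every distribution vector -/

/-- A point with non-zero second coordinate is not of the form `pt e 0`. [folklore] -/
private theorem pt_ne_pt_zero (h : Nat.Coprime 40 p) {c : ZMod p} (hc : c ≠ 0) (e e' : ZMod 40) :
    pt h e' 0 ≠ pt h e c := fun eq ↦ hc ((pt_inj h).1 eq).2.symm

/-- `ĝ` of a distribution vector at a coordinate point, unfolded. [folklore] -/
private theorem hat_koD (h : Nat.Coprime 40 p) (M : ℕ) (z : ZMod (40 * p)) (e : ZMod 40) (c : ZMod p) :
    hat (koD (40 * p) M z) (pt h e c) =
      ((if (pt h e c).val % M = z.val % M then (1 : ℚ) else 0) -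
        (if (pt h (-e) (-c)).val % M = z.val % M then (1 : ℚ) else 0)) -
      ((if ((40 * p / M : ℕ) : ZMod (40 * p)) * z = pt h e c then (1 : ℚ) else 0) -
        (if ((40 * p / M : ℕ) : ZMod (40 * p)) * z = pt h (-e) (-c) then (1 : ℚ) else 0)) := by
  simp only [hat, koD, neg_pt]
  ring

/-- The distribution vector of level `40p` is zero. [folklore] -/
private theorem koD_top [NeZero (40 * p)] (z w : ZMod (40 * p)) : koD (40 * p) (40 * p) z w = 0 := by
  have h0 : (40 * p) ≠ 0 := NeZero.ne _
  simp only [koD, Nat.mod_eq_of_lt (ZMod.val_lt _), Nat.div_self (Nat.pos_of_ne_zero h0), Nat.cast_one, one_mul]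
  by_cases hw : w = z
  · rw [if_pos (by rw [hw]), if_pos hw.symm, sub_self]
  · rw [if_neg (fun e ↦ hw (ZMod.val_injective _ e)), if_neg (fun e ↦ hw e.symm), sub_self]

/-- Level `k ∣ 40`: `ĝ(e, c) = [e ≡ e_z (k)] − [−e ≡ e_z (k)]` off the fibre `0`. [folklore] -/
private theorem hat_koD_dvd_forty (h : Nat.Coprime 40 p) [NeZero (40 * p)] {k : ℕ} (hk : k ∣ 40) (hk0 : 0 < k)
    (ez e : ZMod 40) {bz c : ZMod p} (hc : c ≠ 0) : hat (koD (40 * p) k (pt h ez bz)) (pt h e c) =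
      (if e.val % k = ez.val % k then (1 : ℚ) else 0) - (if (-e).val % k = ez.val % k then (1 : ℚ) else 0) := by
  rw [hat_koD]
  obtain ⟨j, hj⟩ := hk
  have hjk : (40 * p / k : ℕ) = j * p := by
    rw [hj, mul_assoc]; exact Nat.mul_div_cancel_left _ hk0
  have hP : ((j * p : ℕ) : ZMod p) = 0 := by rw [Nat.cast_mul, ZMod.natCast_self, mul_zero]
  have n1 : ((j * p : ℕ) : ZMod (40 * p)) * pt h ez bz ≠ pt h e c := by
    rw [natCast_mul_pt, hP, zero_mul]; exact pt_ne_pt_zero h hc _ _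
  have n2 : ((j * p : ℕ) : ZMod (40 * p)) * pt h ez bz ≠ pt h (-e) (-c) := by
    rw [natCast_mul_pt, hP, zero_mul]; exact pt_ne_pt_zero h (neg_ne_zero.2 hc) _ _
  rw [hjk, if_neg n1, if_neg n2]
  simp only [mod_dvd_forty_iff h ⟨j, hj⟩, crt_pt, sub_zero]

/-- Level `p`: `ĝ(e, c) = [c = b_z] − [−c = b_z] − [0 = e, 40b_z = c] + [0 = −e, 40b_z = −c]`. [folklore] -/
private theorem hat_koD_P (h : Nat.Coprime 40 p) [NeZero (40 * p)] (hp : p.Prime) (ez e : ZMod 40) (bz c : ZMod p) :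
    hat (koD (40 * p) p (pt h ez bz)) (pt h e c) =
      ((if c = bz then (1 : ℚ) else 0) - (if -c = bz then (1 : ℚ) else 0)) -
      ((if 0 = e ∧ 40 * bz = c then (1 : ℚ) else 0) - (if 0 = -e ∧ 40 * bz = -c then (1 : ℚ) else 0)) := by
  rw [hat_koD]
  have h12 : (40 * p / p : ℕ) = 40 := Nat.mul_div_cancel 40 hp.pos
  have h120 : (40 : ZMod 40) * ez = 0 := by rw [show (40 : ZMod 40) = 0 by decide, zero_mul]
  rw [h12]
  simp only [natCast_mul_eq_pt_iff]
  simp only [mod_p_iff h, crt_pt, Nat.cast_ofNat, h120]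

/-- Level `k·p`, `k ∣ 40`, `40 = j·k`: `ĝ(e, c) = [e ≡ e_z (k), c = b_z] − [−e ≡ e_z (k), −c = b_z] − [j e_z = e, j b_z = c]
 + [j e_z = −e, j b_z = −c]`. [folklore] -/
private theorem hat_koD_mulP (h : Nat.Coprime 40 p) [NeZero (40 * p)] (hp : p.Prime) {k j : ℕ} (hjk : 40 = j * k)
    (ez e : ZMod 40) (bz c : ZMod p) :
    hat (koD (40 * p) (k * p) (pt h ez bz)) (pt h e c) =
      ((if e.val % k = ez.val % k ∧ c = bz then (1 : ℚ) else 0) -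
        (if (-e).val % k = ez.val % k ∧ -c = bz then (1 : ℚ) else 0)) -
      ((if (j : ZMod 40) * ez = e ∧ (j : ZMod p) * bz = c then (1 : ℚ) else 0) -
        (if (j : ZMod 40) * ez = -e ∧ (j : ZMod p) * bz = -c then (1 : ℚ) else 0)) := by
  rw [hat_koD]
  have hk0 : 0 < k := Nat.pos_of_ne_zero fun h0 ↦ by rw [h0, mul_zero] at hjk; exact absurd hjk (by norm_num)
  have hj : (40 * p / (k * p) : ℕ) = j := by
    rw [hjk, show j * k * p = j * (k * p) by ring]; exact Nat.mul_div_cancel j (Nat.mul_pos hk0 hp.pos)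
  rw [hj]
  simp only [natCast_mul_eq_pt_iff]
  simp only [mod_dvd_forty_mul_iff h ⟨j, by rw [hjk, mul_comm]⟩, crt_pt]

/-- `ZR` kills `D_{1,z}`. [folklore] -/
private theorem ZR_koD_1 (h : Nat.Coprime 40 p) [NeZero (40 * p)] (_hp : p.Prime) (_h7 : 7 ≤ p)
    (ez : ZMod 40) (bz : ZMod p) {c : ZMod p} (hc : c ≠ 0) : ZR h (koD (40 * p) 1 (pt h ez bz)) c = 0 := by
  simp only [ZR,
    hat_koD_dvd_forty h (by norm_num : 1 ∣ 40) (by norm_num) _ _ hc]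
  fin_cases ez <;> simp +decide

/-- `ZR` kills `D_{2,z}`. [folklore] -/
private theorem ZR_koD_2 (h : Nat.Coprime 40 p) [NeZero (40 * p)] (_hp : p.Prime) (_h7 : 7 ≤ p)
    (ez : ZMod 40) (bz : ZMod p) {c : ZMod p} (hc : c ≠ 0) : ZR h (koD (40 * p) 2 (pt h ez bz)) c = 0 := by
  simp only [ZR,
    hat_koD_dvd_forty h (by norm_num : 2 ∣ 40) (by norm_num) _ _ hc]
  fin_cases ez <;> simp +decide

/-- `ZR` kills `D_{4,z}`. [folklore] -/
private theorem ZR_koD_4 (h : Nat.Coprime 40 p) [NeZero (40 * p)] (_hp : p.Prime) (_h7 : 7 ≤ p)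
    (ez : ZMod 40) (bz : ZMod p) {c : ZMod p} (hc : c ≠ 0) : ZR h (koD (40 * p) 4 (pt h ez bz)) c = 0 := by
  simp only [ZR,
    hat_koD_dvd_forty h (by norm_num : 4 ∣ 40) (by norm_num) _ _ hc]
  fin_cases ez <;> simp +decide

/-- `ZR` kills `D_{5,z}`. [folklore] -/
private theorem ZR_koD_5 (h : Nat.Coprime 40 p) [NeZero (40 * p)] (_hp : p.Prime) (_h7 : 7 ≤ p)
    (ez : ZMod 40) (bz : ZMod p) {c : ZMod p} (hc : c ≠ 0) : ZR h (koD (40 * p) 5 (pt h ez bz)) c = 0 := by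
  simp only [ZR,
    hat_koD_dvd_forty h (by norm_num : 5 ∣ 40) (by norm_num) _ _ hc]
  fin_cases ez <;> simp +decide

/-- `ZR` kills `D_{8,z}`. [folklore] -/
private theorem ZR_koD_8 (h : Nat.Coprime 40 p) [NeZero (40 * p)] (_hp : p.Prime) (_h7 : 7 ≤ p)
    (ez : ZMod 40) (bz : ZMod p) {c : ZMod p} (hc : c ≠ 0) : ZR h (koD (40 * p) 8 (pt h ez bz)) c = 0 := by
  simp only [ZR,
    hat_koD_dvd_forty h (by norm_num : 8 ∣ 40) (by norm_num) _ _ hc]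
  fin_cases ez <;> simp +decide

/-- `ZR` kills `D_{10,z}`. [folklore] -/
private theorem ZR_koD_10 (h : Nat.Coprime 40 p) [NeZero (40 * p)] (_hp : p.Prime) (_h7 : 7 ≤ p)
    (ez : ZMod 40) (bz : ZMod p) {c : ZMod p} (hc : c ≠ 0) : ZR h (koD (40 * p) 10 (pt h ez bz)) c = 0 := by
  simp only [ZR,
    hat_koD_dvd_forty h (by norm_num : 10 ∣ 40) (by norm_num) _ _ hc]
  fin_cases ez <;> simp +decide

/-- `ZR` kills `D_{20,z}`. [folklore] -/
private theorem ZR_koD_20 (h : Nat.Coprime 40 p) [NeZero (40 * p)] (_hp : p.Prime) (_h7 : 7 ≤ p)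
    (ez : ZMod 40) (bz : ZMod p) {c : ZMod p} (hc : c ≠ 0) : ZR h (koD (40 * p) 20 (pt h ez bz)) c = 0 := by
  simp only [ZR,
    hat_koD_dvd_forty h (by norm_num : 20 ∣ 40) (by norm_num) _ _ hc]
  fin_cases ez <;> simp +decide

/-- `ZR` kills `D_{40,z}`. [folklore] -/
private theorem ZR_koD_40 (h : Nat.Coprime 40 p) [NeZero (40 * p)] (_hp : p.Prime) (_h7 : 7 ≤ p)
    (ez : ZMod 40) (bz : ZMod p) {c : ZMod p} (hc : c ≠ 0) : ZR h (koD (40 * p) 40 (pt h ez bz)) c = 0 := by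
  simp only [ZR,
    hat_koD_dvd_forty h (by norm_num : 40 ∣ 40) (by norm_num) _ _ hc]
  fin_cases ez <;> simp +decide

/-- `ZR` kills `D_{p,z}`. [folklore] -/
private theorem ZR_koD_P (h : Nat.Coprime 40 p) [NeZero (40 * p)] (hp : p.Prime) (h7 : 7 ≤ p)
    (ez : ZMod 40) (bz : ZMod p) (c : ZMod p) : ZR h (koD (40 * p) p (pt h ez bz)) c = 0 := by
  simp only [ZR, hat_koD_P h hp]
  fin_cases ez <;> simp +decide [atoms hp h7 c bz]

/-- `ZR` kills `D_{2p,z}`. [folklore] -/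
private theorem ZR_koD_2P (h : Nat.Coprime 40 p) [NeZero (40 * p)] (hp : p.Prime) (h7 : 7 ≤ p)
    (ez : ZMod 40) (bz : ZMod p) (c : ZMod p) : ZR h (koD (40 * p) (2 * p) (pt h ez bz)) c = 0 := by
  simp only [ZR, hat_koD_mulP h hp (k := 2) (j := 20) (by norm_num), Nat.cast_ofNat]
  fin_cases ez <;> simp +decide [atoms hp h7 c bz]

/-- `ZR` kills `D_{4p,z}`. [folklore] -/
private theorem ZR_koD_4P (h : Nat.Coprime 40 p) [NeZero (40 * p)] (hp : p.Prime) (h7 : 7 ≤ p)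
    (ez : ZMod 40) (bz : ZMod p) (c : ZMod p) : ZR h (koD (40 * p) (4 * p) (pt h ez bz)) c = 0 := by
  simp only [ZR, hat_koD_mulP h hp (k := 4) (j := 10) (by norm_num), Nat.cast_ofNat]
  fin_cases ez <;> simp +decide [atoms hp h7 c bz]

/-- `ZR` kills `D_{5p,z}`. [folklore] -/
private theorem ZR_koD_5P (h : Nat.Coprime 40 p) [NeZero (40 * p)] (hp : p.Prime) (h7 : 7 ≤ p)
    (ez : ZMod 40) (bz : ZMod p) (c : ZMod p) : ZR h (koD (40 * p) (5 * p) (pt h ez bz)) c = 0 := by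
  simp only [ZR, hat_koD_mulP h hp (k := 5) (j := 8) (by norm_num), Nat.cast_ofNat]
  fin_cases ez <;> simp +decide [atoms hp h7 c bz] <;> ring

/-- `ZR` kills `D_{8p,z}`. [folklore] -/
private theorem ZR_koD_8P (h : Nat.Coprime 40 p) [NeZero (40 * p)] (hp : p.Prime) (h7 : 7 ≤ p)
    (ez : ZMod 40) (bz : ZMod p) (c : ZMod p) : ZR h (koD (40 * p) (8 * p) (pt h ez bz)) c = 0 := by
  simp only [ZR, hat_koD_mulP h hp (k := 8) (j := 5) (by norm_num), Nat.cast_ofNat]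
  fin_cases ez <;> simp +decide [atoms hp h7 c bz]

/-- `ZR` kills `D_{10p,z}`. [folklore] -/
private theorem ZR_koD_10P (h : Nat.Coprime 40 p) [NeZero (40 * p)] (hp : p.Prime) (h7 : 7 ≤ p)
    (ez : ZMod 40) (bz : ZMod p) (c : ZMod p) : ZR h (koD (40 * p) (10 * p) (pt h ez bz)) c = 0 := by
  simp only [ZR, hat_koD_mulP h hp (k := 10) (j := 4) (by norm_num), Nat.cast_ofNat]
  fin_cases ez <;> simp +decide [atoms hp h7 c bz] <;> ring

/-- `ZR` kills `D_{20p,z}`. [folklore] -/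
private theorem ZR_koD_20P (h : Nat.Coprime 40 p) [NeZero (40 * p)] (hp : p.Prime) (h7 : 7 ≤ p)
    (ez : ZMod 40) (bz : ZMod p) (c : ZMod p) : ZR h (koD (40 * p) (20 * p) (pt h ez bz)) c = 0 := by
  simp only [ZR, hat_koD_mulP h hp (k := 20) (j := 2) (by norm_num), Nat.cast_ofNat]
  fin_cases ez <;> simp +decide [atoms hp h7 c bz] <;> ring

/-- **`ZR` kills every distribution vector.** [folklore] -/
private theorem ZR_koD (h : Nat.Coprime 40 p) [NeZero (40 * p)] (hp : p.Prime) (h7 : 7 ≤ p) {M : ℕ}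
    (hM : M ∈ (40 * p).divisors) (z : ZMod (40 * p)) {c : ZMod p} (hc : c ≠ 0) : ZR h (koD (40 * p) M z) c = 0 := by
  obtain ⟨ez, bz, rfl⟩ : ∃ ez bz, z = pt h ez bz := ⟨_, _, (pt_crt h z).symm⟩
  rcases eq_of_dvd_forty_mul_prime hp h7 (Nat.dvd_of_mem_divisors hM) with
    rfl | rfl | rfl | rfl | rfl | rfl | rfl | rfl | rfl | rfl | rfl | rfl | rfl | rfl | rfl | hM40
  · exact ZR_koD_1 h hp h7 ez bz hc
  · exact ZR_koD_2 h hp h7 ez bz hc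
  · exact ZR_koD_4 h hp h7 ez bz hc
  · exact ZR_koD_5 h hp h7 ez bz hc
  · exact ZR_koD_8 h hp h7 ez bz hc
  · exact ZR_koD_10 h hp h7 ez bz hc
  · exact ZR_koD_20 h hp h7 ez bz hc
  · exact ZR_koD_40 h hp h7 ez bz hc
  · exact ZR_koD_P h hp h7 ez bz c
  · exact ZR_koD_2P h hp h7 ez bz c
  · exact ZR_koD_4P h hp h7 ez bz c
  · exact ZR_koD_5P h hp h7 ez bz c
  · exact ZR_koD_8P h hp h7 ez bz c
  · exact ZR_koD_10P h hp h7 ez bz c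
  · exact ZR_koD_20P h hp h7 ez bz c
  · rw [hM40]
    simp [ZR, hat, koD_top]

/-- `ZI` kills `D_{1,z}`. [folklore] -/
private theorem ZI_koD_1 (h : Nat.Coprime 40 p) [NeZero (40 * p)] (_hp : p.Prime) (_h7 : 7 ≤ p)
    (ez : ZMod 40) (bz : ZMod p) {c : ZMod p} (hc : c ≠ 0) : ZI h (koD (40 * p) 1 (pt h ez bz)) c = 0 := by
  simp only [ZI,
    hat_koD_dvd_forty h (by norm_num : 1 ∣ 40) (by norm_num) _ _ hc]
  fin_cases ez <;> simp +decide

/-- `ZI` kills `D_{2,z}`. [folklore] -/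
private theorem ZI_koD_2 (h : Nat.Coprime 40 p) [NeZero (40 * p)] (_hp : p.Prime) (_h7 : 7 ≤ p)
    (ez : ZMod 40) (bz : ZMod p) {c : ZMod p} (hc : c ≠ 0) : ZI h (koD (40 * p) 2 (pt h ez bz)) c = 0 := by
  simp only [ZI,
    hat_koD_dvd_forty h (by norm_num : 2 ∣ 40) (by norm_num) _ _ hc]
  fin_cases ez <;> simp +decide

/-- `ZI` kills `D_{4,z}`. [folklore] -/
private theorem ZI_koD_4 (h : Nat.Coprime 40 p) [NeZero (40 * p)] (_hp : p.Prime) (_h7 : 7 ≤ p)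
    (ez : ZMod 40) (bz : ZMod p) {c : ZMod p} (hc : c ≠ 0) : ZI h (koD (40 * p) 4 (pt h ez bz)) c = 0 := by
  simp only [ZI,
    hat_koD_dvd_forty h (by norm_num : 4 ∣ 40) (by norm_num) _ _ hc]
  fin_cases ez <;> simp +decide

/-- `ZI` kills `D_{5,z}`. [folklore] -/
private theorem ZI_koD_5 (h : Nat.Coprime 40 p) [NeZero (40 * p)] (_hp : p.Prime) (_h7 : 7 ≤ p)
    (ez : ZMod 40) (bz : ZMod p) {c : ZMod p} (hc : c ≠ 0) : ZI h (koD (40 * p) 5 (pt h ez bz)) c = 0 := by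
  simp only [ZI,
    hat_koD_dvd_forty h (by norm_num : 5 ∣ 40) (by norm_num) _ _ hc]
  fin_cases ez <;> simp +decide

/-- `ZI` kills `D_{8,z}`. [folklore] -/
private theorem ZI_koD_8 (h : Nat.Coprime 40 p) [NeZero (40 * p)] (_hp : p.Prime) (_h7 : 7 ≤ p)
    (ez : ZMod 40) (bz : ZMod p) {c : ZMod p} (hc : c ≠ 0) : ZI h (koD (40 * p) 8 (pt h ez bz)) c = 0 := by
  simp only [ZI,
    hat_koD_dvd_forty h (by norm_num : 8 ∣ 40) (by norm_num) _ _ hc]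
  fin_cases ez <;> simp +decide

/-- `ZI` kills `D_{10,z}`. [folklore] -/
private theorem ZI_koD_10 (h : Nat.Coprime 40 p) [NeZero (40 * p)] (_hp : p.Prime) (_h7 : 7 ≤ p)
    (ez : ZMod 40) (bz : ZMod p) {c : ZMod p} (hc : c ≠ 0) : ZI h (koD (40 * p) 10 (pt h ez bz)) c = 0 := by
  simp only [ZI,
    hat_koD_dvd_forty h (by norm_num : 10 ∣ 40) (by norm_num) _ _ hc]
  fin_cases ez <;> simp +decide

/-- `ZI` kills `D_{20,z}`. [folklore] -/
private theorem ZI_koD_20 (h : Nat.Coprime 40 p) [NeZero (40 * p)] (_hp : p.Prime) (_h7 : 7 ≤ p)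
    (ez : ZMod 40) (bz : ZMod p) {c : ZMod p} (hc : c ≠ 0) : ZI h (koD (40 * p) 20 (pt h ez bz)) c = 0 := by
  simp only [ZI,
    hat_koD_dvd_forty h (by norm_num : 20 ∣ 40) (by norm_num) _ _ hc]
  fin_cases ez <;> simp +decide

/-- `ZI` kills `D_{40,z}`. [folklore] -/
private theorem ZI_koD_40 (h : Nat.Coprime 40 p) [NeZero (40 * p)] (_hp : p.Prime) (_h7 : 7 ≤ p)
    (ez : ZMod 40) (bz : ZMod p) {c : ZMod p} (hc : c ≠ 0) : ZI h (koD (40 * p) 40 (pt h ez bz)) c = 0 := by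
  simp only [ZI,
    hat_koD_dvd_forty h (by norm_num : 40 ∣ 40) (by norm_num) _ _ hc]
  fin_cases ez <;> simp +decide

/-- `ZI` kills `D_{p,z}`. [folklore] -/
private theorem ZI_koD_P (h : Nat.Coprime 40 p) [NeZero (40 * p)] (hp : p.Prime) (h7 : 7 ≤ p)
    (ez : ZMod 40) (bz : ZMod p) (c : ZMod p) : ZI h (koD (40 * p) p (pt h ez bz)) c = 0 := by
  simp only [ZI, hat_koD_P h hp]
  fin_cases ez <;> simp +decide [atoms hp h7 c bz]

/-- `ZI` kills `D_{2p,z}`. [folklore] -/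
private theorem ZI_koD_2P (h : Nat.Coprime 40 p) [NeZero (40 * p)] (hp : p.Prime) (h7 : 7 ≤ p)
    (ez : ZMod 40) (bz : ZMod p) (c : ZMod p) : ZI h (koD (40 * p) (2 * p) (pt h ez bz)) c = 0 := by
  simp only [ZI, hat_koD_mulP h hp (k := 2) (j := 20) (by norm_num), Nat.cast_ofNat]
  fin_cases ez <;> simp +decide [atoms hp h7 c bz]

/-- `ZI` kills `D_{4p,z}`. [folklore] -/
private theorem ZI_koD_4P (h : Nat.Coprime 40 p) [NeZero (40 * p)] (hp : p.Prime) (h7 : 7 ≤ p)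
    (ez : ZMod 40) (bz : ZMod p) (c : ZMod p) : ZI h (koD (40 * p) (4 * p) (pt h ez bz)) c = 0 := by
  simp only [ZI, hat_koD_mulP h hp (k := 4) (j := 10) (by norm_num), Nat.cast_ofNat]
  fin_cases ez <;> simp +decide [atoms hp h7 c bz] <;> ring

/-- `ZI` kills `D_{5p,z}`. [folklore] -/
private theorem ZI_koD_5P (h : Nat.Coprime 40 p) [NeZero (40 * p)] (hp : p.Prime) (h7 : 7 ≤ p)
    (ez : ZMod 40) (bz : ZMod p) (c : ZMod p) : ZI h (koD (40 * p) (5 * p) (pt h ez bz)) c = 0 := by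
  simp only [ZI, hat_koD_mulP h hp (k := 5) (j := 8) (by norm_num), Nat.cast_ofNat]
  fin_cases ez <;> simp +decide [atoms hp h7 c bz] <;> ring

/-- `ZI` kills `D_{8p,z}`. [folklore] -/
private theorem ZI_koD_8P (h : Nat.Coprime 40 p) [NeZero (40 * p)] (hp : p.Prime) (h7 : 7 ≤ p)
    (ez : ZMod 40) (bz : ZMod p) (c : ZMod p) : ZI h (koD (40 * p) (8 * p) (pt h ez bz)) c = 0 := by
  simp only [ZI, hat_koD_mulP h hp (k := 8) (j := 5) (by norm_num), Nat.cast_ofNat]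
  fin_cases ez <;> simp +decide [atoms hp h7 c bz]

/-- `ZI` kills `D_{10p,z}`. [folklore] -/
private theorem ZI_koD_10P (h : Nat.Coprime 40 p) [NeZero (40 * p)] (hp : p.Prime) (h7 : 7 ≤ p)
    (ez : ZMod 40) (bz : ZMod p) (c : ZMod p) : ZI h (koD (40 * p) (10 * p) (pt h ez bz)) c = 0 := by
  simp only [ZI, hat_koD_mulP h hp (k := 10) (j := 4) (by norm_num), Nat.cast_ofNat]
  fin_cases ez <;> simp +decide [atoms hp h7 c bz] <;> ring

/-- `ZI` kills `D_{20p,z}`. [folklore] -/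
private theorem ZI_koD_20P (h : Nat.Coprime 40 p) [NeZero (40 * p)] (hp : p.Prime) (h7 : 7 ≤ p)
    (ez : ZMod 40) (bz : ZMod p) (c : ZMod p) : ZI h (koD (40 * p) (20 * p) (pt h ez bz)) c = 0 := by
  simp only [ZI, hat_koD_mulP h hp (k := 20) (j := 2) (by norm_num), Nat.cast_ofNat]
  fin_cases ez <;> simp +decide [atoms hp h7 c bz]

/-- **`ZI` kills every distribution vector.** [folklore] -/
private theorem ZI_koD (h : Nat.Coprime 40 p) [NeZero (40 * p)] (hp : p.Prime) (h7 : 7 ≤ p) {M : ℕ}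
    (hM : M ∈ (40 * p).divisors) (z : ZMod (40 * p)) {c : ZMod p} (hc : c ≠ 0) : ZI h (koD (40 * p) M z) c = 0 := by
  obtain ⟨ez, bz, rfl⟩ : ∃ ez bz, z = pt h ez bz := ⟨_, _, (pt_crt h z).symm⟩
  rcases eq_of_dvd_forty_mul_prime hp h7 (Nat.dvd_of_mem_divisors hM) with
    rfl | rfl | rfl | rfl | rfl | rfl | rfl | rfl | rfl | rfl | rfl | rfl | rfl | rfl | rfl | hM40
  · exact ZI_koD_1 h hp h7 ez bz hc
  · exact ZI_koD_2 h hp h7 ez bz hc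
  · exact ZI_koD_4 h hp h7 ez bz hc
  · exact ZI_koD_5 h hp h7 ez bz hc
  · exact ZI_koD_8 h hp h7 ez bz hc
  · exact ZI_koD_10 h hp h7 ez bz hc
  · exact ZI_koD_20 h hp h7 ez bz hc
  · exact ZI_koD_40 h hp h7 ez bz hc
  · exact ZI_koD_P h hp h7 ez bz c
  · exact ZI_koD_2P h hp h7 ez bz c
  · exact ZI_koD_4P h hp h7 ez bz c
  · exact ZI_koD_5P h hp h7 ez bz c
  · exact ZI_koD_8P h hp h7 ez bz c
  · exact ZI_koD_10P h hp h7 ez bz c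
  · exact ZI_koD_20P h hp h7 ez bz c
  · rw [hM40]
    simp [ZI, hat, koD_top]

/-- `E8` kills `D_{1,z}`. [folklore] -/
private theorem E8_koD_1 (h : Nat.Coprime 40 p) [NeZero (40 * p)] (hp : p.Prime) (h7 : 7 ≤ p)
    (ez : ZMod 40) (bz : ZMod p) {c : ZMod p} (hc : c ≠ 0) : E8 h (koD (40 * p) 1 (pt h ez bz)) c = 0 := by
  obtain ⟨hc2, hc4, hc5, hc8, hc10, hc20, hc40⟩ := mul_ne_zero_facts hp h7 hc
  simp only [E8,
    hat_koD_dvd_forty h (by norm_num : 1 ∣ 40) (by norm_num) _ _ hc,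
    hat_koD_dvd_forty h (by norm_num : 1 ∣ 40) (by norm_num) _ _ hc5]
  fin_cases ez <;> simp +decide

/-- `E8` kills `D_{2,z}`. [folklore] -/
private theorem E8_koD_2 (h : Nat.Coprime 40 p) [NeZero (40 * p)] (hp : p.Prime) (h7 : 7 ≤ p)
    (ez : ZMod 40) (bz : ZMod p) {c : ZMod p} (hc : c ≠ 0) : E8 h (koD (40 * p) 2 (pt h ez bz)) c = 0 := by
  obtain ⟨hc2, hc4, hc5, hc8, hc10, hc20, hc40⟩ := mul_ne_zero_facts hp h7 hc
  simp only [E8,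
    hat_koD_dvd_forty h (by norm_num : 2 ∣ 40) (by norm_num) _ _ hc,
    hat_koD_dvd_forty h (by norm_num : 2 ∣ 40) (by norm_num) _ _ hc5]
  fin_cases ez <;> simp +decide

/-- `E8` kills `D_{4,z}`. [folklore] -/
private theorem E8_koD_4 (h : Nat.Coprime 40 p) [NeZero (40 * p)] (hp : p.Prime) (h7 : 7 ≤ p)
    (ez : ZMod 40) (bz : ZMod p) {c : ZMod p} (hc : c ≠ 0) : E8 h (koD (40 * p) 4 (pt h ez bz)) c = 0 := by
  obtain ⟨hc2, hc4, hc5, hc8, hc10, hc20, hc40⟩ := mul_ne_zero_facts hp h7 hc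
  simp only [E8,
    hat_koD_dvd_forty h (by norm_num : 4 ∣ 40) (by norm_num) _ _ hc,
    hat_koD_dvd_forty h (by norm_num : 4 ∣ 40) (by norm_num) _ _ hc5]
  fin_cases ez <;> simp +decide

/-- `E8` kills `D_{5,z}`. [folklore] -/
private theorem E8_koD_5 (h : Nat.Coprime 40 p) [NeZero (40 * p)] (hp : p.Prime) (h7 : 7 ≤ p)
    (ez : ZMod 40) (bz : ZMod p) {c : ZMod p} (hc : c ≠ 0) : E8 h (koD (40 * p) 5 (pt h ez bz)) c = 0 := by
  obtain ⟨hc2, hc4, hc5, hc8, hc10, hc20, hc40⟩ := mul_ne_zero_facts hp h7 hc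
  simp only [E8,
    hat_koD_dvd_forty h (by norm_num : 5 ∣ 40) (by norm_num) _ _ hc,
    hat_koD_dvd_forty h (by norm_num : 5 ∣ 40) (by norm_num) _ _ hc5]
  fin_cases ez <;> simp +decide

/-- `E8` kills `D_{8,z}`. [folklore] -/
private theorem E8_koD_8 (h : Nat.Coprime 40 p) [NeZero (40 * p)] (hp : p.Prime) (h7 : 7 ≤ p)
    (ez : ZMod 40) (bz : ZMod p) {c : ZMod p} (hc : c ≠ 0) : E8 h (koD (40 * p) 8 (pt h ez bz)) c = 0 := by
  obtain ⟨hc2, hc4, hc5, hc8, hc10, hc20, hc40⟩ := mul_ne_zero_facts hp h7 hc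
  simp only [E8,
    hat_koD_dvd_forty h (by norm_num : 8 ∣ 40) (by norm_num) _ _ hc,
    hat_koD_dvd_forty h (by norm_num : 8 ∣ 40) (by norm_num) _ _ hc5]
  fin_cases ez <;> simp +decide

/-- `E8` kills `D_{10,z}`. [folklore] -/
private theorem E8_koD_10 (h : Nat.Coprime 40 p) [NeZero (40 * p)] (hp : p.Prime) (h7 : 7 ≤ p)
    (ez : ZMod 40) (bz : ZMod p) {c : ZMod p} (hc : c ≠ 0) : E8 h (koD (40 * p) 10 (pt h ez bz)) c = 0 := by
  obtain ⟨hc2, hc4, hc5, hc8, hc10, hc20, hc40⟩ := mul_ne_zero_facts hp h7 hc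
  simp only [E8,
    hat_koD_dvd_forty h (by norm_num : 10 ∣ 40) (by norm_num) _ _ hc,
    hat_koD_dvd_forty h (by norm_num : 10 ∣ 40) (by norm_num) _ _ hc5]
  fin_cases ez <;> simp +decide

/-- `E8` kills `D_{20,z}`. [folklore] -/
private theorem E8_koD_20 (h : Nat.Coprime 40 p) [NeZero (40 * p)] (hp : p.Prime) (h7 : 7 ≤ p)
    (ez : ZMod 40) (bz : ZMod p) {c : ZMod p} (hc : c ≠ 0) : E8 h (koD (40 * p) 20 (pt h ez bz)) c = 0 := by
  obtain ⟨hc2, hc4, hc5, hc8, hc10, hc20, hc40⟩ := mul_ne_zero_facts hp h7 hc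
  simp only [E8,
    hat_koD_dvd_forty h (by norm_num : 20 ∣ 40) (by norm_num) _ _ hc,
    hat_koD_dvd_forty h (by norm_num : 20 ∣ 40) (by norm_num) _ _ hc5]
  fin_cases ez <;> simp +decide

/-- `E8` kills `D_{40,z}`. [folklore] -/
private theorem E8_koD_40 (h : Nat.Coprime 40 p) [NeZero (40 * p)] (hp : p.Prime) (h7 : 7 ≤ p)
    (ez : ZMod 40) (bz : ZMod p) {c : ZMod p} (hc : c ≠ 0) : E8 h (koD (40 * p) 40 (pt h ez bz)) c = 0 := by
  obtain ⟨hc2, hc4, hc5, hc8, hc10, hc20, hc40⟩ := mul_ne_zero_facts hp h7 hc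
  simp only [E8,
    hat_koD_dvd_forty h (by norm_num : 40 ∣ 40) (by norm_num) _ _ hc,
    hat_koD_dvd_forty h (by norm_num : 40 ∣ 40) (by norm_num) _ _ hc5]
  fin_cases ez <;> simp +decide

/-- `E8` kills `D_{p,z}`. [folklore] -/
private theorem E8_koD_P (h : Nat.Coprime 40 p) [NeZero (40 * p)] (hp : p.Prime) (h7 : 7 ≤ p)
    (ez : ZMod 40) (bz : ZMod p) (c : ZMod p) : E8 h (koD (40 * p) p (pt h ez bz)) c = 0 := by
  simp only [E8, hat_koD_P h hp]
  fin_cases ez <;> simp +decide [atoms hp h7 c bz]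

/-- `E8` kills `D_{2p,z}`. [folklore] -/
private theorem E8_koD_2P (h : Nat.Coprime 40 p) [NeZero (40 * p)] (hp : p.Prime) (h7 : 7 ≤ p)
    (ez : ZMod 40) (bz : ZMod p) (c : ZMod p) : E8 h (koD (40 * p) (2 * p) (pt h ez bz)) c = 0 := by
  simp only [E8, hat_koD_mulP h hp (k := 2) (j := 20) (by norm_num), Nat.cast_ofNat]
  fin_cases ez <;> simp +decide [atoms hp h7 c bz]

/-- `E8` kills `D_{4p,z}`. [folklore] -/
private theorem E8_koD_4P (h : Nat.Coprime 40 p) [NeZero (40 * p)] (hp : p.Prime) (h7 : 7 ≤ p)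
    (ez : ZMod 40) (bz : ZMod p) (c : ZMod p) : E8 h (koD (40 * p) (4 * p) (pt h ez bz)) c = 0 := by
  simp only [E8, hat_koD_mulP h hp (k := 4) (j := 10) (by norm_num), Nat.cast_ofNat]
  fin_cases ez <;> simp +decide [atoms hp h7 c bz] <;> ring

/-- `E8` kills `D_{5p,z}`. [folklore] -/
private theorem E8_koD_5P (h : Nat.Coprime 40 p) [NeZero (40 * p)] (hp : p.Prime) (h7 : 7 ≤ p)
    (ez : ZMod 40) (bz : ZMod p) (c : ZMod p) : E8 h (koD (40 * p) (5 * p) (pt h ez bz)) c = 0 := by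
  simp only [E8, hat_koD_mulP h hp (k := 5) (j := 8) (by norm_num), Nat.cast_ofNat]
  fin_cases ez <;> simp +decide [atoms hp h7 c bz] <;> ring

/-- `E8` kills `D_{8p,z}`. [folklore] -/
private theorem E8_koD_8P (h : Nat.Coprime 40 p) [NeZero (40 * p)] (hp : p.Prime) (h7 : 7 ≤ p)
    (ez : ZMod 40) (bz : ZMod p) (c : ZMod p) : E8 h (koD (40 * p) (8 * p) (pt h ez bz)) c = 0 := by
  simp only [E8, hat_koD_mulP h hp (k := 8) (j := 5) (by norm_num), Nat.cast_ofNat]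
  fin_cases ez <;> simp +decide [atoms hp h7 c bz] <;> ring

/-- `E8` kills `D_{10p,z}`. [folklore] -/
private theorem E8_koD_10P (h : Nat.Coprime 40 p) [NeZero (40 * p)] (hp : p.Prime) (h7 : 7 ≤ p)
    (ez : ZMod 40) (bz : ZMod p) (c : ZMod p) : E8 h (koD (40 * p) (10 * p) (pt h ez bz)) c = 0 := by
  simp only [E8, hat_koD_mulP h hp (k := 10) (j := 4) (by norm_num), Nat.cast_ofNat]
  fin_cases ez <;> simp +decide [atoms hp h7 c bz] <;> ring

/-- `E8` kills `D_{20p,z}`. [folklore] -/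
private theorem E8_koD_20P (h : Nat.Coprime 40 p) [NeZero (40 * p)] (hp : p.Prime) (h7 : 7 ≤ p)
    (ez : ZMod 40) (bz : ZMod p) (c : ZMod p) : E8 h (koD (40 * p) (20 * p) (pt h ez bz)) c = 0 := by
  simp only [E8, hat_koD_mulP h hp (k := 20) (j := 2) (by norm_num), Nat.cast_ofNat]
  fin_cases ez <;> simp +decide [atoms hp h7 c bz] <;> ring

/-- **`E8` kills every distribution vector.** [folklore] -/
private theorem E8_koD (h : Nat.Coprime 40 p) [NeZero (40 * p)] (hp : p.Prime) (h7 : 7 ≤ p) {M : ℕ}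
    (hM : M ∈ (40 * p).divisors) (z : ZMod (40 * p)) {c : ZMod p} (hc : c ≠ 0) : E8 h (koD (40 * p) M z) c = 0 := by
  obtain ⟨ez, bz, rfl⟩ : ∃ ez bz, z = pt h ez bz := ⟨_, _, (pt_crt h z).symm⟩
  rcases eq_of_dvd_forty_mul_prime hp h7 (Nat.dvd_of_mem_divisors hM) with
    rfl | rfl | rfl | rfl | rfl | rfl | rfl | rfl | rfl | rfl | rfl | rfl | rfl | rfl | rfl | hM40
  · exact E8_koD_1 h hp h7 ez bz hc
  · exact E8_koD_2 h hp h7 ez bz hc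
  · exact E8_koD_4 h hp h7 ez bz hc
  · exact E8_koD_5 h hp h7 ez bz hc
  · exact E8_koD_8 h hp h7 ez bz hc
  · exact E8_koD_10 h hp h7 ez bz hc
  · exact E8_koD_20 h hp h7 ez bz hc
  · exact E8_koD_40 h hp h7 ez bz hc
  · exact E8_koD_P h hp h7 ez bz c
  · exact E8_koD_2P h hp h7 ez bz c
  · exact E8_koD_4P h hp h7 ez bz c
  · exact E8_koD_5P h hp h7 ez bz c
  · exact E8_koD_8P h hp h7 ez bz c
  · exact E8_koD_10P h hp h7 ez bz c
  · exact E8_koD_20P h hp h7 ez bz c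
  · rw [hM40]
    simp [E8, hat, koD_top]

/-- `L8` kills `D_{1,z}`. [folklore] -/
private theorem L8_koD_1 (h : Nat.Coprime 40 p) [NeZero (40 * p)] (hp : p.Prime) (h7 : 7 ≤ p)
    (ez : ZMod 40) (bz : ZMod p) {c c' : ZMod p} (hc : c ≠ 0) (hc' : c' ≠ 0) :
    L8 h (koD (40 * p) 1 (pt h ez bz)) c c' = 0 := by
  obtain ⟨hc2, hc4, hc5, hc8, hc10, hc20, hc40⟩ := mul_ne_zero_facts hp h7 hc
  obtain ⟨hd2, hd4, hd5, hd8, hd10, hd20, hd40⟩ := mul_ne_zero_facts hp h7 hc'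
  simp only [L8, G8,
    hat_koD_dvd_forty h (by norm_num : 1 ∣ 40) (by norm_num) _ _ hc,
    hat_koD_dvd_forty h (by norm_num : 1 ∣ 40) (by norm_num) _ _ hc5,
    hat_koD_dvd_forty h (by norm_num : 1 ∣ 40) (by norm_num) _ _ hc',
    hat_koD_dvd_forty h (by norm_num : 1 ∣ 40) (by norm_num) _ _ hd5]
  fin_cases ez <;> simp +decide

/-- `L8` kills `D_{2,z}`. [folklore] -/
private theorem L8_koD_2 (h : Nat.Coprime 40 p) [NeZero (40 * p)] (hp : p.Prime) (h7 : 7 ≤ p)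
    (ez : ZMod 40) (bz : ZMod p) {c c' : ZMod p} (hc : c ≠ 0) (hc' : c' ≠ 0) :
    L8 h (koD (40 * p) 2 (pt h ez bz)) c c' = 0 := by
  obtain ⟨hc2, hc4, hc5, hc8, hc10, hc20, hc40⟩ := mul_ne_zero_facts hp h7 hc
  obtain ⟨hd2, hd4, hd5, hd8, hd10, hd20, hd40⟩ := mul_ne_zero_facts hp h7 hc'
  simp only [L8, G8,
    hat_koD_dvd_forty h (by norm_num : 2 ∣ 40) (by norm_num) _ _ hc,
    hat_koD_dvd_forty h (by norm_num : 2 ∣ 40) (by norm_num) _ _ hc5,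
    hat_koD_dvd_forty h (by norm_num : 2 ∣ 40) (by norm_num) _ _ hc',
    hat_koD_dvd_forty h (by norm_num : 2 ∣ 40) (by norm_num) _ _ hd5]
  fin_cases ez <;> simp +decide

/-- `L8` kills `D_{4,z}`. [folklore] -/
private theorem L8_koD_4 (h : Nat.Coprime 40 p) [NeZero (40 * p)] (hp : p.Prime) (h7 : 7 ≤ p)
    (ez : ZMod 40) (bz : ZMod p) {c c' : ZMod p} (hc : c ≠ 0) (hc' : c' ≠ 0) :
    L8 h (koD (40 * p) 4 (pt h ez bz)) c c' = 0 := by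
  obtain ⟨hc2, hc4, hc5, hc8, hc10, hc20, hc40⟩ := mul_ne_zero_facts hp h7 hc
  obtain ⟨hd2, hd4, hd5, hd8, hd10, hd20, hd40⟩ := mul_ne_zero_facts hp h7 hc'
  simp only [L8, G8,
    hat_koD_dvd_forty h (by norm_num : 4 ∣ 40) (by norm_num) _ _ hc,
    hat_koD_dvd_forty h (by norm_num : 4 ∣ 40) (by norm_num) _ _ hc5,
    hat_koD_dvd_forty h (by norm_num : 4 ∣ 40) (by norm_num) _ _ hc',
    hat_koD_dvd_forty h (by norm_num : 4 ∣ 40) (by norm_num) _ _ hd5]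
  fin_cases ez <;> simp +decide

/-- `L8` kills `D_{5,z}`. [folklore] -/
private theorem L8_koD_5 (h : Nat.Coprime 40 p) [NeZero (40 * p)] (hp : p.Prime) (h7 : 7 ≤ p)
    (ez : ZMod 40) (bz : ZMod p) {c c' : ZMod p} (hc : c ≠ 0) (hc' : c' ≠ 0) :
    L8 h (koD (40 * p) 5 (pt h ez bz)) c c' = 0 := by
  obtain ⟨hc2, hc4, hc5, hc8, hc10, hc20, hc40⟩ := mul_ne_zero_facts hp h7 hc
  obtain ⟨hd2, hd4, hd5, hd8, hd10, hd20, hd40⟩ := mul_ne_zero_facts hp h7 hc'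
  simp only [L8, G8,
    hat_koD_dvd_forty h (by norm_num : 5 ∣ 40) (by norm_num) _ _ hc,
    hat_koD_dvd_forty h (by norm_num : 5 ∣ 40) (by norm_num) _ _ hc5,
    hat_koD_dvd_forty h (by norm_num : 5 ∣ 40) (by norm_num) _ _ hc',
    hat_koD_dvd_forty h (by norm_num : 5 ∣ 40) (by norm_num) _ _ hd5]
  fin_cases ez <;> simp +decide

/-- `L8` kills `D_{8,z}`. [folklore] -/
private theorem L8_koD_8 (h : Nat.Coprime 40 p) [NeZero (40 * p)] (hp : p.Prime) (h7 : 7 ≤ p)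
    (ez : ZMod 40) (bz : ZMod p) {c c' : ZMod p} (hc : c ≠ 0) (hc' : c' ≠ 0) :
    L8 h (koD (40 * p) 8 (pt h ez bz)) c c' = 0 := by
  obtain ⟨hc2, hc4, hc5, hc8, hc10, hc20, hc40⟩ := mul_ne_zero_facts hp h7 hc
  obtain ⟨hd2, hd4, hd5, hd8, hd10, hd20, hd40⟩ := mul_ne_zero_facts hp h7 hc'
  simp only [L8, G8,
    hat_koD_dvd_forty h (by norm_num : 8 ∣ 40) (by norm_num) _ _ hc,
    hat_koD_dvd_forty h (by norm_num : 8 ∣ 40) (by norm_num) _ _ hc5,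
    hat_koD_dvd_forty h (by norm_num : 8 ∣ 40) (by norm_num) _ _ hc',
    hat_koD_dvd_forty h (by norm_num : 8 ∣ 40) (by norm_num) _ _ hd5]
  fin_cases ez <;> simp +decide

/-- `L8` kills `D_{10,z}`. [folklore] -/
private theorem L8_koD_10 (h : Nat.Coprime 40 p) [NeZero (40 * p)] (hp : p.Prime) (h7 : 7 ≤ p)
    (ez : ZMod 40) (bz : ZMod p) {c c' : ZMod p} (hc : c ≠ 0) (hc' : c' ≠ 0) :
    L8 h (koD (40 * p) 10 (pt h ez bz)) c c' = 0 := by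
  obtain ⟨hc2, hc4, hc5, hc8, hc10, hc20, hc40⟩ := mul_ne_zero_facts hp h7 hc
  obtain ⟨hd2, hd4, hd5, hd8, hd10, hd20, hd40⟩ := mul_ne_zero_facts hp h7 hc'
  simp only [L8, G8,
    hat_koD_dvd_forty h (by norm_num : 10 ∣ 40) (by norm_num) _ _ hc,
    hat_koD_dvd_forty h (by norm_num : 10 ∣ 40) (by norm_num) _ _ hc5,
    hat_koD_dvd_forty h (by norm_num : 10 ∣ 40) (by norm_num) _ _ hc',
    hat_koD_dvd_forty h (by norm_num : 10 ∣ 40) (by norm_num) _ _ hd5]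
  fin_cases ez <;> simp +decide

/-- `L8` kills `D_{20,z}`. [folklore] -/
private theorem L8_koD_20 (h : Nat.Coprime 40 p) [NeZero (40 * p)] (hp : p.Prime) (h7 : 7 ≤ p)
    (ez : ZMod 40) (bz : ZMod p) {c c' : ZMod p} (hc : c ≠ 0) (hc' : c' ≠ 0) :
    L8 h (koD (40 * p) 20 (pt h ez bz)) c c' = 0 := by
  obtain ⟨hc2, hc4, hc5, hc8, hc10, hc20, hc40⟩ := mul_ne_zero_facts hp h7 hc
  obtain ⟨hd2, hd4, hd5, hd8, hd10, hd20, hd40⟩ := mul_ne_zero_facts hp h7 hc'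
  simp only [L8, G8,
    hat_koD_dvd_forty h (by norm_num : 20 ∣ 40) (by norm_num) _ _ hc,
    hat_koD_dvd_forty h (by norm_num : 20 ∣ 40) (by norm_num) _ _ hc5,
    hat_koD_dvd_forty h (by norm_num : 20 ∣ 40) (by norm_num) _ _ hc',
    hat_koD_dvd_forty h (by norm_num : 20 ∣ 40) (by norm_num) _ _ hd5]
  fin_cases ez <;> simp +decide

/-- `L8` kills `D_{40,z}`. [folklore] -/
private theorem L8_koD_40 (h : Nat.Coprime 40 p) [NeZero (40 * p)] (hp : p.Prime) (h7 : 7 ≤ p)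
    (ez : ZMod 40) (bz : ZMod p) {c c' : ZMod p} (hc : c ≠ 0) (hc' : c' ≠ 0) :
    L8 h (koD (40 * p) 40 (pt h ez bz)) c c' = 0 := by
  obtain ⟨hc2, hc4, hc5, hc8, hc10, hc20, hc40⟩ := mul_ne_zero_facts hp h7 hc
  obtain ⟨hd2, hd4, hd5, hd8, hd10, hd20, hd40⟩ := mul_ne_zero_facts hp h7 hc'
  simp only [L8, G8,
    hat_koD_dvd_forty h (by norm_num : 40 ∣ 40) (by norm_num) _ _ hc,
    hat_koD_dvd_forty h (by norm_num : 40 ∣ 40) (by norm_num) _ _ hc5,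
    hat_koD_dvd_forty h (by norm_num : 40 ∣ 40) (by norm_num) _ _ hc',
    hat_koD_dvd_forty h (by norm_num : 40 ∣ 40) (by norm_num) _ _ hd5]
  fin_cases ez <;> simp +decide

set_option maxHeartbeats 1000000 in
/-- `L8` kills `D_{p,z}`. [folklore] -/
private theorem L8_koD_P (h : Nat.Coprime 40 p) [NeZero (40 * p)] (hp : p.Prime) (h7 : 7 ≤ p)
    (ez : ZMod 40) (bz : ZMod p) (c c' : ZMod p) : L8 h (koD (40 * p) p (pt h ez bz)) c c' = 0 := by
  simp only [L8, G8, hat_koD_P h hp]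
  fin_cases ez <;> simp +decide [atoms hp h7 c bz, atoms hp h7 c' bz]

set_option maxHeartbeats 1000000 in
/-- `L8` kills `D_{2p,z}`. [folklore] -/
private theorem L8_koD_2P (h : Nat.Coprime 40 p) [NeZero (40 * p)] (hp : p.Prime) (h7 : 7 ≤ p)
    (ez : ZMod 40) (bz : ZMod p) (c c' : ZMod p) : L8 h (koD (40 * p) (2 * p) (pt h ez bz)) c c' = 0 := by
  simp only [L8, G8, hat_koD_mulP h hp (k := 2) (j := 20) (by norm_num), Nat.cast_ofNat]
  fin_cases ez <;> simp +decide [atoms hp h7 c bz, atoms hp h7 c' bz]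

set_option maxHeartbeats 1000000 in
/-- `L8` kills `D_{4p,z}`. [folklore] -/
private theorem L8_koD_4P (h : Nat.Coprime 40 p) [NeZero (40 * p)] (hp : p.Prime) (h7 : 7 ≤ p)
    (ez : ZMod 40) (bz : ZMod p) (c c' : ZMod p) : L8 h (koD (40 * p) (4 * p) (pt h ez bz)) c c' = 0 := by
  simp only [L8, G8, hat_koD_mulP h hp (k := 4) (j := 10) (by norm_num), Nat.cast_ofNat]
  fin_cases ez <;> simp +decide [atoms hp h7 c bz, atoms hp h7 c' bz] <;> ring

set_option maxHeartbeats 1000000 in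
/-- `L8` kills `D_{5p,z}`. [folklore] -/
private theorem L8_koD_5P (h : Nat.Coprime 40 p) [NeZero (40 * p)] (hp : p.Prime) (h7 : 7 ≤ p)
    (ez : ZMod 40) (bz : ZMod p) (c c' : ZMod p) : L8 h (koD (40 * p) (5 * p) (pt h ez bz)) c c' = 0 := by
  simp only [L8, G8, hat_koD_mulP h hp (k := 5) (j := 8) (by norm_num), Nat.cast_ofNat]
  fin_cases ez <;> simp +decide [atoms hp h7 c bz, atoms hp h7 c' bz] <;> ring

set_option maxHeartbeats 1000000 in
/-- `L8` kills `D_{8p,z}`. [folklore] -/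
private theorem L8_koD_8P (h : Nat.Coprime 40 p) [NeZero (40 * p)] (hp : p.Prime) (h7 : 7 ≤ p)
    (ez : ZMod 40) (bz : ZMod p) (c c' : ZMod p) : L8 h (koD (40 * p) (8 * p) (pt h ez bz)) c c' = 0 := by
  simp only [L8, G8, hat_koD_mulP h hp (k := 8) (j := 5) (by norm_num), Nat.cast_ofNat]
  fin_cases ez <;> simp +decide [atoms hp h7 c bz, atoms hp h7 c' bz] <;> ring

set_option maxHeartbeats 1000000 in
/-- `L8` kills `D_{10p,z}`. [folklore] -/
private theorem L8_koD_10P (h : Nat.Coprime 40 p) [NeZero (40 * p)] (hp : p.Prime) (h7 : 7 ≤ p)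
    (ez : ZMod 40) (bz : ZMod p) (c c' : ZMod p) : L8 h (koD (40 * p) (10 * p) (pt h ez bz)) c c' = 0 := by
  simp only [L8, G8, hat_koD_mulP h hp (k := 10) (j := 4) (by norm_num), Nat.cast_ofNat]
  fin_cases ez <;> simp +decide [atoms hp h7 c bz, atoms hp h7 c' bz] <;> ring

set_option maxHeartbeats 1000000 in
/-- `L8` kills `D_{20p,z}`. [folklore] -/
private theorem L8_koD_20P (h : Nat.Coprime 40 p) [NeZero (40 * p)] (hp : p.Prime) (h7 : 7 ≤ p)
    (ez : ZMod 40) (bz : ZMod p) (c c' : ZMod p) : L8 h (koD (40 * p) (20 * p) (pt h ez bz)) c c' = 0 := by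
  simp only [L8, G8, hat_koD_mulP h hp (k := 20) (j := 2) (by norm_num), Nat.cast_ofNat]
  fin_cases ez <;> simp +decide [atoms hp h7 c bz, atoms hp h7 c' bz] <;> ring

/-- **`L8` kills every distribution vector.** [folklore] -/
private theorem L8_koD (h : Nat.Coprime 40 p) [NeZero (40 * p)] (hp : p.Prime) (h7 : 7 ≤ p) {M : ℕ}
    (hM : M ∈ (40 * p).divisors) (z : ZMod (40 * p)) {c c' : ZMod p} (hc : c ≠ 0) (hc' : c' ≠ 0) :
    L8 h (koD (40 * p) M z) c c' = 0 := by
  obtain ⟨ez, bz, rfl⟩ : ∃ ez bz, z = pt h ez bz := ⟨_, _, (pt_crt h z).symm⟩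
  rcases eq_of_dvd_forty_mul_prime hp h7 (Nat.dvd_of_mem_divisors hM) with
    rfl | rfl | rfl | rfl | rfl | rfl | rfl | rfl | rfl | rfl | rfl | rfl | rfl | rfl | rfl | hM40
  · exact L8_koD_1 h hp h7 ez bz hc hc'
  · exact L8_koD_2 h hp h7 ez bz hc hc'
  · exact L8_koD_4 h hp h7 ez bz hc hc'
  · exact L8_koD_5 h hp h7 ez bz hc hc'
  · exact L8_koD_8 h hp h7 ez bz hc hc'
  · exact L8_koD_10 h hp h7 ez bz hc hc'
  · exact L8_koD_20 h hp h7 ez bz hc hc'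
  · exact L8_koD_40 h hp h7 ez bz hc hc'
  · exact L8_koD_P h hp h7 ez bz c c'
  · exact L8_koD_2P h hp h7 ez bz c c'
  · exact L8_koD_4P h hp h7 ez bz c c'
  · exact L8_koD_5P h hp h7 ez bz c c'
  · exact L8_koD_8P h hp h7 ez bz c c'
  · exact L8_koD_10P h hp h7 ez bz c c'
  · exact L8_koD_20P h hp h7 ez bz c c'
  · rw [hM40]
    simp [L8, G8, hat, koD_top]

/-! ### The relations on Hodge multisets of level `40p` -/

/-- **Koblitz–Ogus, functional form:** a linear functional on `ℚ^{ℤ/40p}` that kills the negation-invariant functions and all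
distribution vectors kills the multiplicity function of every Hodge multiset (the tree's PROVED
`KoblitzOgus.hodge_eq_combination`; as in `KoblitzOgusRelationsTwentyPrime`). [cite: Deligne1982HodgeCycles, Rem. 7.16 (a)] -/
private theorem functional_count_eq_zero [NeZero (40 * p)] {s : Multiset (ZMod (40 * p))} (hs : IsHodgeMultiset s)
    (L : (ZMod (40 * p) → ℚ) → ℚ)
    (hadd : ∀ g g' : ZMod (40 * p) → ℚ, L (fun z ↦ g z + g' z) = L g + L g')
    (hmul : ∀ (a : ℚ) (g : ZMod (40 * p) → ℚ), L (fun z ↦ a * g z) = a * L g)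
    (hsum : ∀ {ι : Type} (t : Finset ι) (g : ι → ZMod (40 * p) → ℚ), L (fun z ↦ ∑ i ∈ t, g i z) = ∑ i ∈ t, L (g i))
    (heven : ∀ g : ZMod (40 * p) → ℚ, (∀ z, g (-z) = g z) → L g = 0)
    (hko : ∀ M ∈ (40 * p).divisors, ∀ y : ZMod (40 * p), L (koD (40 * p) M y) = 0) :
    L (fun w ↦ (count w s : ℚ)) = 0 := by
  classical
  obtain ⟨cr, cd, hrep⟩ := Literature.NumberTheory.Transcendental.KoblitzOgus.hodge_eq_combination
    (N := 40 * p) (fun x ↦ (count x s : ℚ)) (fun u hu ↦ hs.sum_count_mul_bern_eq_zero hu)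
  have hf : (fun w ↦ (count w s : ℚ)) =
      fun w ↦ (∑ a : ZMod (40 * p), cr a * ((if a = w then (1 : ℚ) else 0) + (if -a = w then 1 else 0))) +
        ∑ M ∈ (40 * p).divisors, ∑ y : ZMod (40 * p), cd M y * koD (40 * p) M y w := funext hrep
  rw [hf, hadd, hsum, hsum]
  have hA : ∀ a : ZMod (40 * p),
      L (fun w ↦ cr a * ((if a = w then (1 : ℚ) else 0) + (if -a = w then 1 else 0))) = 0 := fun a ↦ by
    rw [hmul, heven _ fun w ↦ ?_, mul_zero]
    rw [add_comm]
    congr 1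
    · simp only [neg_inj]
    · simp only [eq_neg_iff_add_eq_zero, neg_eq_iff_add_eq_zero]
  have hB : ∀ M ∈ (40 * p).divisors, L (fun w ↦ ∑ y : ZMod (40 * p), cd M y * koD (40 * p) M y w) = 0 :=
    fun M hM ↦ by
      rw [hsum]
      refine Finset.sum_eq_zero fun y _ ↦ ?_
      rw [hmul, hko M hM y, mul_zero]
  rw [Finset.sum_eq_zero fun a _ ↦ hA a, Finset.sum_eq_zero hB, add_zero]

/-- `ZR` kills the multiplicity function of every Hodge multiset. [cite: Deligne1982HodgeCycles, Rem. 7.16 (a)] -/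
private theorem ZR_count_eq_zero (h : Nat.Coprime 40 p) [NeZero (40 * p)] (hp : p.Prime) (h7 : 7 ≤ p)
    {s : Multiset (ZMod (40 * p))} (hs : IsHodgeMultiset s) {c : ZMod p} (hc : c ≠ 0) :
    ZR h (fun w ↦ (count w s : ℚ)) c = 0 := by
  have lin := ZR_linear h c
  exact functional_count_eq_zero hs (fun g ↦ ZR h g c) lin.1 lin.2.1 (fun t g ↦ lin.2.2.1 t g) lin.2.2.2
    (fun M hM y ↦ ZR_koD h hp h7 hM y hc)

/-- `ZI` kills the multiplicity function of every Hodge multiset. [cite: Deligne1982HodgeCycles, Rem. 7.16 (a)] -/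
private theorem ZI_count_eq_zero (h : Nat.Coprime 40 p) [NeZero (40 * p)] (hp : p.Prime) (h7 : 7 ≤ p)
    {s : Multiset (ZMod (40 * p))} (hs : IsHodgeMultiset s) {c : ZMod p} (hc : c ≠ 0) :
    ZI h (fun w ↦ (count w s : ℚ)) c = 0 := by
  have lin := ZI_linear h c
  exact functional_count_eq_zero hs (fun g ↦ ZI h g c) lin.1 lin.2.1 (fun t g ↦ lin.2.2.1 t g) lin.2.2.2
    (fun M hM y ↦ ZI_koD h hp h7 hM y hc)

/-- `E8` kills the multiplicity function of every Hodge multiset. [cite: Deligne1982HodgeCycles, Rem. 7.16 (a)] -/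
private theorem E8_count_eq_zero (h : Nat.Coprime 40 p) [NeZero (40 * p)] (hp : p.Prime) (h7 : 7 ≤ p)
    {s : Multiset (ZMod (40 * p))} (hs : IsHodgeMultiset s) {c : ZMod p} (hc : c ≠ 0) :
    E8 h (fun w ↦ (count w s : ℚ)) c = 0 := by
  have lin := E8_linear h c
  exact functional_count_eq_zero hs (fun g ↦ E8 h g c) lin.1 lin.2.1 (fun t g ↦ lin.2.2.1 t g) lin.2.2.2
    (fun M hM y ↦ E8_koD h hp h7 hM y hc)

/-- `L8` kills the multiplicity function of every Hodge multiset. [cite: Deligne1982HodgeCycles, Rem. 7.16 (a)] -/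
private theorem L8_count_eq_zero (h : Nat.Coprime 40 p) [NeZero (40 * p)] (hp : p.Prime) (h7 : 7 ≤ p)
    {s : Multiset (ZMod (40 * p))} (hs : IsHodgeMultiset s) {c c' : ZMod p} (hc : c ≠ 0) (hc' : c' ≠ 0) :
    L8 h (fun w ↦ (count w s : ℚ)) c c' = 0 := by
  have lin := L8_linear h c c'
  exact functional_count_eq_zero hs (fun g ↦ L8 h g c c') lin.1 lin.2.1 (fun t g ↦ lin.2.2.1 t g) lin.2.2.2
    (fun M hM y ↦ L8_koD h hp h7 hM y hc hc')

/-! ### Public statements -/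

/-- The residue of `ℤ/40p` with Chinese-remainder coordinates `(u, c) ∈ ℤ/40 × ℤ/p` (plumbing for the statements below). [folklore] -/
def crtPt40 (h : Nat.Coprime 40 p) (u : ZMod 40) (c : ZMod p) : ZMod (40 * p) := (ZMod.chineseRemainder h).symm (u, c)

/-- `crtPt40` is the private `pt`. [folklore] -/
private theorem crtPt40_eq (h : Nat.Coprime 40 p) (u : ZMod 40) (c : ZMod p) : crtPt40 h u c = pt h u c := rfl

/-- `ĝ` of the multiplicity function is the tree's `oddCt`, cast to `ℚ`. [folklore] -/
private theorem hat_count_eq (s : Multiset (ZMod (40 * p))) (w : ZMod (40 * p)) :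
    hat (fun w ↦ (count w s : ℚ)) w = (oddCt s w : ℚ) := by
  simp only [hat, oddCt, Int.cast_sub, Int.cast_natCast]

/-- **First Koblitz–Ogus relation at level `40p` used by the classification** (the odd characters `χ₋₈ω^{±1}ψ`, `χ₋₈ω^{±1}` the even
quartic characters of conductor `40` (`ω` the quartic character mod `5` with `ω(2) = i`), real part; a single fibre of units): for every
Hodge multiset `s` of level `40p`, `p ≥ 7` prime, and every `c ≢ 0 (mod p)`, with `ô(u, c) = #_{(u,c)}(s) − #_{(−u,−c)}(s)` in the
coordinates `ℤ/40p ≅ ℤ/40 × ℤ/p`: `ô(1,c) − ô(9,c) + ô(11,c) − ô(19,c) − ô(21,c) + ô(29,c) − ô(31,c) + ô(39,c) = 0`.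
[cite: Deligne1982HodgeCycles, Rem. 7.16 (a)] [cite: Aoki1983, Prop. 2.2] [cite: Shioda1982PicardFermat, §3 p. 727] -/
theorem relM8OmegaRe_fortyPrime [NeZero (40 * p)] (hp : p.Prime) (h7 : 7 ≤ p) (h : Nat.Coprime 40 p)
    {s : Multiset (ZMod (40 * p))} (hs : IsHodgeMultiset s) {c : ZMod p} (hc : c ≠ 0) :
    oddCt s (crtPt40 h 1 c) - oddCt s (crtPt40 h 9 c) + oddCt s (crtPt40 h 11 c) - oddCt s (crtPt40 h 19 c) - oddCt
      s (crtPt40 h 21 c) + oddCt s (crtPt40 h 29 c) - oddCt s (crtPt40 h 31 c) + oddCt s (crtPt40 h 39 c) = 0 := by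
  have key := ZR_count_eq_zero h hp h7 hs hc
  simp only [ZR, hat_count_eq, ← crtPt40_eq] at key
  have key' : ((
      oddCt s (crtPt40 h 1 c) - oddCt s (crtPt40 h 9 c) + oddCt s (crtPt40 h 11 c) - oddCt s (crtPt40 h 19 c) -
        oddCt s (crtPt40 h 21 c) + oddCt s (crtPt40 h 29 c) - oddCt s (crtPt40 h 31 c) + oddCt s (crtPt40 h 39 c) :
        ℤ) : ℚ) = 0 := by
    push_cast
    linear_combination key
  exact_mod_cast key'

/-- **Second Koblitz–Ogus relation at level `40p` used by the classification** (imaginary part of the even quartic characters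
`χ₋₈ω^{±1}` of conductor `40`; a single fibre of units): for every Hodge multiset `s` of level `40p`, `p ≥ 7` prime, and every
`c ≢ 0 (mod p)`: `−ô(3,c) − ô(7,c) + ô(13,c) + ô(17,c) + ô(23,c) + ô(27,c) − ô(33,c) − ô(37,c) = 0`.
[cite: Deligne1982HodgeCycles, Rem. 7.16 (a)] [cite: Aoki1983, Prop. 2.2] [cite: Shioda1982PicardFermat, §3 p. 727] -/
theorem relM8OmegaIm_fortyPrime [NeZero (40 * p)] (hp : p.Prime) (h7 : 7 ≤ p) (h : Nat.Coprime 40 p)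
    {s : Multiset (ZMod (40 * p))} (hs : IsHodgeMultiset s) {c : ZMod p} (hc : c ≠ 0) :
    -oddCt s (crtPt40 h 3 c) - oddCt s (crtPt40 h 7 c) + oddCt s (crtPt40 h 13 c) + oddCt s (crtPt40 h 17 c) + oddCt
      s (crtPt40 h 23 c) + oddCt s (crtPt40 h 27 c) - oddCt s (crtPt40 h 33 c) - oddCt s (crtPt40 h 37 c) = 0 := by
  have key := ZI_count_eq_zero h hp h7 hs hc
  simp only [ZI, hat_count_eq, ← crtPt40_eq] at key
  have key' : ((
      -oddCt s (crtPt40 h 3 c) - oddCt s (crtPt40 h 7 c) + oddCt s (crtPt40 h 13 c) + oddCt s (crtPt40 h 17 c) +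
        oddCt s (crtPt40 h 23 c) + oddCt s (crtPt40 h 27 c) - oddCt s (crtPt40 h 33 c) - oddCt s (crtPt40 h 37 c) :
        ℤ) : ℚ) = 0 := by
    push_cast
    linear_combination key
  exact_mod_cast key'

/-- **Third Koblitz–Ogus relation at level `40p` used by the classification** (the odd characters `χ₈ψ`, `χ₈` the even quadratic
character of conductor `8`; fibres `c` (units, weight `χ₈(u)`) and `5c` (units, weight `χ₈(u)`, and odd multiples `v` of `5`, weight
`4χ₈(v/5)`)): for every Hodge multiset `s` of level `40p`, `p ≥ 7` prime, and every `c ≢ 0 (mod p)`: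
`Σ_{u∈U} χ₈(u)(ô(u,c) + ô(u,5c)) + 4(ô(5,5c) − ô(15,5c) − ô(25,5c) + ô(35,5c)) = 0`.
[cite: Deligne1982HodgeCycles, Rem. 7.16 (a)] [cite: Aoki1983, Prop. 2.2] [cite: Shioda1982PicardFermat, §3 p. 727] -/
theorem relChi8_fortyPrime [NeZero (40 * p)] (hp : p.Prime) (h7 : 7 ≤ p) (h : Nat.Coprime 40 p)
    {s : Multiset (ZMod (40 * p))} (hs : IsHodgeMultiset s) {c : ZMod p} (hc : c ≠ 0) :
    oddCt s (crtPt40 h 1 c) - oddCt s (crtPt40 h 3 c) + oddCt s (crtPt40 h 7 c) + oddCt s (crtPt40 h 9 c) - oddCt s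
      (crtPt40 h 11 c) - oddCt s (crtPt40 h 13 c) + oddCt s (crtPt40 h 17 c) - oddCt s (crtPt40 h 19 c) - oddCt s
      (crtPt40 h 21 c) + oddCt s (crtPt40 h 23 c) - oddCt s (crtPt40 h 27 c) - oddCt s (crtPt40 h 29 c) + oddCt s
      (crtPt40 h 31 c) + oddCt s (crtPt40 h 33 c) - oddCt s (crtPt40 h 37 c) + oddCt s (crtPt40 h 39 c) + oddCt s
      (crtPt40 h 1 (5 * c)) - oddCt s (crtPt40 h 3 (5 * c)) + oddCt s (crtPt40 h 7 (5 * c)) + oddCt s (crtPt40 h 9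
      (5 * c)) - oddCt s (crtPt40 h 11 (5 * c)) - oddCt s (crtPt40 h 13 (5 * c)) + oddCt s (crtPt40 h 17 (5 * c)) -
      oddCt s (crtPt40 h 19 (5 * c)) - oddCt s (crtPt40 h 21 (5 * c)) + oddCt s (crtPt40 h 23 (5 * c)) - oddCt s
      (crtPt40 h 27 (5 * c)) - oddCt s (crtPt40 h 29 (5 * c)) + oddCt s (crtPt40 h 31 (5 * c)) + oddCt s (crtPt40 h
      33 (5 * c)) - oddCt s (crtPt40 h 37 (5 * c)) + oddCt s (crtPt40 h 39 (5 * c)) + 4 * oddCt s (crtPt40 h 5 (5 *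
      c)) - 4 * oddCt s (crtPt40 h 15 (5 * c)) - 4 * oddCt s (crtPt40 h 25 (5 * c)) + 4 * oddCt s (crtPt40 h 35 (5 *
      c)) = 0 := by
  have key := E8_count_eq_zero h hp h7 hs hc
  simp only [E8, hat_count_eq, ← crtPt40_eq] at key
  have key' : ((
      oddCt s (crtPt40 h 1 c) - oddCt s (crtPt40 h 3 c) + oddCt s (crtPt40 h 7 c) + oddCt s (crtPt40 h 9 c) - oddCt
        s (crtPt40 h 11 c) - oddCt s (crtPt40 h 13 c) + oddCt s (crtPt40 h 17 c) - oddCt s (crtPt40 h 19 c) - oddCt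
        s (crtPt40 h 21 c) + oddCt s (crtPt40 h 23 c) - oddCt s (crtPt40 h 27 c) - oddCt s (crtPt40 h 29 c) + oddCt
        s (crtPt40 h 31 c) + oddCt s (crtPt40 h 33 c) - oddCt s (crtPt40 h 37 c) + oddCt s (crtPt40 h 39 c) + oddCt
        s (crtPt40 h 1 (5 * c)) - oddCt s (crtPt40 h 3 (5 * c)) + oddCt s (crtPt40 h 7 (5 * c)) + oddCt s (crtPt40 h
        9 (5 * c)) - oddCt s (crtPt40 h 11 (5 * c)) - oddCt s (crtPt40 h 13 (5 * c)) + oddCt s (crtPt40 h 17 (5 *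
        c)) - oddCt s (crtPt40 h 19 (5 * c)) - oddCt s (crtPt40 h 21 (5 * c)) + oddCt s (crtPt40 h 23 (5 * c)) -
        oddCt s (crtPt40 h 27 (5 * c)) - oddCt s (crtPt40 h 29 (5 * c)) + oddCt s (crtPt40 h 31 (5 * c)) + oddCt s
        (crtPt40 h 33 (5 * c)) - oddCt s (crtPt40 h 37 (5 * c)) + oddCt s (crtPt40 h 39 (5 * c)) + 4 * oddCt s
        (crtPt40 h 5 (5 * c)) - 4 * oddCt s (crtPt40 h 15 (5 * c)) - 4 * oddCt s (crtPt40 h 25 (5 * c)) + 4 * oddCt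
        s (crtPt40 h 35 (5 * c)) : ℤ) : ℚ) = 0 := by
    push_cast
    linear_combination key
  exact_mod_cast key'

/-- `Γ₋₈(c) = −Σ_{u∈U} χ₋₈(u)(ô(u,c) + ô(u,5c)) − 4 Σ_{v∈{5,15,25,35}} χ₋₈(v/5) ô(v,5c)` of a multiset `s` of level `40p`
(`χ₋₈(u) = 1` for `u ≡ 1, 3 (mod 8)`, `−1` for `u ≡ 5, 7 (mod 8)`), written out. [folklore] -/
def gammaM8Sum40 (h : Nat.Coprime 40 p) (s : Multiset (ZMod (40 * p))) (c : ZMod p) : ℤ :=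
  -oddCt s (crtPt40 h 1 c) - oddCt s (crtPt40 h 3 c) + oddCt s (crtPt40 h 7 c) - oddCt s (crtPt40 h 9 c) - oddCt s
    (crtPt40 h 11 c) + oddCt s (crtPt40 h 13 c) - oddCt s (crtPt40 h 17 c) - oddCt s (crtPt40 h 19 c) + oddCt s
    (crtPt40 h 21 c) + oddCt s (crtPt40 h 23 c) - oddCt s (crtPt40 h 27 c) + oddCt s (crtPt40 h 29 c) + oddCt s
    (crtPt40 h 31 c) - oddCt s (crtPt40 h 33 c) + oddCt s (crtPt40 h 37 c) + oddCt s (crtPt40 h 39 c) - oddCt s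
    (crtPt40 h 1 (5 * c)) - oddCt s (crtPt40 h 3 (5 * c)) + oddCt s (crtPt40 h 7 (5 * c)) - oddCt s (crtPt40 h 9 (5
    * c)) - oddCt s (crtPt40 h 11 (5 * c)) + oddCt s (crtPt40 h 13 (5 * c)) - oddCt s (crtPt40 h 17 (5 * c)) - oddCt
    s (crtPt40 h 19 (5 * c)) + oddCt s (crtPt40 h 21 (5 * c)) + oddCt s (crtPt40 h 23 (5 * c)) - oddCt s (crtPt40 h
    27 (5 * c)) + oddCt s (crtPt40 h 29 (5 * c)) + oddCt s (crtPt40 h 31 (5 * c)) - oddCt s (crtPt40 h 33 (5 * c)) +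
    oddCt s (crtPt40 h 37 (5 * c)) + oddCt s (crtPt40 h 39 (5 * c)) - 4 * oddCt s (crtPt40 h 5 (5 * c)) - 4 * oddCt
    s (crtPt40 h 15 (5 * c)) + 4 * oddCt s (crtPt40 h 25 (5 * c)) + 4 * oddCt s (crtPt40 h 35 (5 * c))

/-- `G8` of the multiplicity function is `gammaM8Sum40`. [folklore] -/
private theorem G8_count_eq (h : Nat.Coprime 40 p) (s : Multiset (ZMod (40 * p))) (c : ZMod p) :
    G8 h (fun w ↦ (count w s : ℚ)) c = (gammaM8Sum40 h s c : ℚ) := by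
  simp only [G8, hat_count_eq, ← crtPt40_eq, gammaM8Sum40]
  push_cast
  ring

/-- **Koblitz–Ogus relation of the character `χ₋₈` at level `40p`** (`p ≥ 7` prime): `Γ₋₈(c) = Γ₋₈(c′)` for all
`c, c′ ≢ 0 (mod p)` (`gammaM8Sum40`). [cite: Deligne1982HodgeCycles, Rem. 7.16 (a)] [cite: Aoki1983, Prop. 2.2] [cite: Shioda1982PicardFermat, §3 p. 727] -/
theorem gammaM8_fortyPrime [NeZero (40 * p)] (hp : p.Prime) (h7 : 7 ≤ p) (h : Nat.Coprime 40 p)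
    {s : Multiset (ZMod (40 * p))} (hs : IsHodgeMultiset s) {c c' : ZMod p} (hc : c ≠ 0) (hc' : c' ≠ 0) :
    gammaM8Sum40 h s c = gammaM8Sum40 h s c' := by
  have key := L8_count_eq_zero h hp h7 hs hc hc'
  rw [L8, G8_count_eq, G8_count_eq, sub_eq_zero] at key
  exact_mod_cast key

end FortyPrime

end Literature.AlgebraicGeometry.Shioda1982
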